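import Literature.Computability.QuantumComplexity.PathModelRepresentation
import HarnessLib

/-!
# Link states for the AJL path model: towards `⟨α|φ(b)|α⟩ = ⟨b^{pl}⟩(A)/d^{n/2-1}`

Topic `Literature/Computability/QuantumComplexity`; second layer of the decomposition of
`ajl_jonesApproxProblem_mem_PromiseBQP` (`JonesInBQP.lean`, plan in `JonesInBQPProofs.lean`):
the algebraic half of a tree proof of the named fact `ajl_thm32_matrixElement`
(`PathModelRepresentation.lean`; D. Aharonov, V. Jones, Z. Landau, arXiv:quant-ph/0511096,
Thm. 3.2). AJL obtain the identity from the uniqueness of the Markov trace on `TL_n(d)` and the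
isomorphism `TL_n(d) ≅ gTL_n(d)` with Kauffman's diagram algebra (Thm. 2.1, Lemmas 2.1–2.2,
Claims 3.6, 3.8). The tree's Kauffman bracket (`kauffmanBracketPlat`) counts loops as connected
components of the smoothed diagram, so a tree proof goes through the *cap-state (link-state)
calculus* instead: the bottom half of a smoothed plat diagram, read up to some level, pairs the
`n` points of that level by a non-crossing perfect matching `M` and has closed off some number
`c` of loops; one more capcup slice `E_i` either closes a loop (`M(i) = i+1`) or splices `M`.
This file attaches to every non-crossing perfect matching `M` an explicit vector `v_M` in the
path-model register (`linkVec`) and proves that the generators `Φ_i` of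
`PathModelRepresentation.lean` act on these vectors exactly as capcups act on cap states:

* `linkVec_closed` (**L1**): `Φ_i v_M = d · v_M` if `M(i) = i + 1`;
* `linkVec_splice` (**L2**): `Φ_i v_M = v_{M ⋆ i}` otherwise, `M ⋆ i` the spliced matching
  (`NCMatching.splice`, non-crossing again: `spliceMate_nc`);
* `linkVec_cups` (**L3**): `v_{M₀} = (√d)^{n/2} |α⟩` for the matching `M₀ = {(2l, 2l+1)}` of the
  plat cups;

and draws the consequences: running the slices of a smoothed word on `v_{M₀}` (`runSlices`,
`foldl_sliceMatrix_mulVec`) and then the closing capcups `E_{n-2}, …, E_0` (which bring every cap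
state back to `M₀`, `runSlices_closingList_fst`) gives, with Claim 3.8, the **core identity**
`d^{n/2} ⟨α| S_L |α⟩ = d^{c_ext(L)}` (`core_identity`), where `c_ext` (`cExt`) is the number of
loops closed by the cap-state calculus. Expanding `φ(w) = ∏_j (c_j Φ + c'_j 1)` over the `2^m`
smoothing states (`prod_ofFn_smul_add`) then proves `ajl_thm32_matrixElement` from the single
combinatorial input `loopCount = cExt` (`ajl_thm32_of_loopCount`), which is the subject of
`JonesLoopCount.lean`.

This is the standard link-pattern (meander) representation of the Temperley–Lieb algebra
realised inside the path model [Kauffman 1987, §2–§4 (bracket states); Di Francesco–Golinelli–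
Guitter 1997, §2 (link patterns and `TL_n`)]; the weights `√(λ_{z'}/λ_z)` attached to an arc whose
outside/inside regions carry the vertices `z`, `z'` of `G_k` are AJL's `a_ℓ, b_ℓ` of §2.12
(Claim 2.6), in the bit-string language of §3.1.

## Definitions

* `NCMatching n`: a fixed-point-free involution `mate` on `Fin n` which is non-crossing
  (`a < t < mate a → a < mate t < mate a`).
* `NCMatching.Compatible M p`: the bits of `p` at the two ends of every arc are opposite (the
  region labelling of AJL §2.12 is consistent); then `pathPos p a = pathPos p (mate a + 1)` and
  `pathPos p (a + 1) = pathPos p (mate a)` for every arc `a < mate a` (`pathPos_arc`).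
* `linkVec k M : QReg n → ℝ`, `v_M(p) = [p ∈ P_{n,k}] [Compatible M p] ∏_{a < mate a} √(λ_{z_{a+1}}/λ_{z_a})`.

## References

* D. Aharonov, V. Jones, Z. Landau, arXiv:quant-ph/0511096, §2.12 (Claims 2.4–2.6), §3.1
  (eq. (3.1), Claim 3.1), Thm. 3.2 with Claim 3.8 [AharonovJonesLandau2009].
* L. H. Kauffman, *State models and the Jones polynomial*, Topology 26 (1987) 395–407.
* P. Di Francesco, O. Golinelli, E. Guitter, *Meanders and the Temperley–Lieb algebra*,
  Comm. Math. Phys. 186 (1997) 1–59, §2.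
-/

noncomputable section

open Matrix Finset

namespace Literature.Computability.QuantumComplexity

variable {n : ℕ}

/-! ### Non-crossing perfect matchings -/

/-- A non-crossing perfect matching of the `n` boundary points `Fin n`: a fixed-point-free
involution no two of whose pairs cross (equivalently: the open interval spanned by a pair is
stable under `mate`). [cite: AharonovJonesLandau2009, Def. 2.3 (Kauffman diagrams)] -/
structure NCMatching (n : ℕ) where
  /-- The partner of a point. -/
  mate : Fin n → Fin n
  /-- `mate` is an involution. -/
  mate_mate : ∀ a, mate (mate a) = a
  /-- `mate` has no fixed point. -/
  mate_ne : ∀ a, mate a ≠ a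
  /-- Non-crossing: a point strictly inside an arc is matched strictly inside that arc. -/
  nc : ∀ a t : Fin n, a < t → t < mate a → a < mate t ∧ mate t < mate a

namespace NCMatching

variable (M : NCMatching n)

/-- `mate` is injective. [folklore] -/
theorem mate_injective : Function.Injective M.mate := fun a b h => by
  rw [← M.mate_mate a, h, M.mate_mate]

/-- Non-crossing, stated for an arc given by its right endpoint. [folklore] -/
theorem nc' (a t : Fin n) (h1 : M.mate a < t) (h2 : t < a) : M.mate a < M.mate t ∧ M.mate t < a := by
  have := M.nc (M.mate a) t h1 (by rwa [M.mate_mate])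
  rwa [M.mate_mate] at this

/-- The set of left endpoints `{a | a < mate a}`. [folklore] -/
def lefts : Finset (Fin n) := Finset.univ.filter fun a => a < M.mate a

/-- Membership in `lefts`. [folklore] -/
@[simp] theorem mem_lefts {a : Fin n} : a ∈ M.lefts ↔ a < M.mate a := by
  simp [lefts]

/-- **Compatibility of a bit string with a matching**: the two ends of every arc carry opposite
bits (AJL §2.12: the labelling of the regions by vertices of `G_k` is consistent).
[cite: AharonovJonesLandau2009, §2.12 (compatible pairs)] -/
def Compatible (p : Cryptography.QReg n) : Prop := ∀ t : Fin n, p (M.mate t) = !p t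

/-- Compatibility is decidable. [folklore] -/
instance (p : Cryptography.QReg n) : Decidable (M.Compatible p) := by
  unfold Compatible; infer_instance

end NCMatching

/-! ### Positions along an arc -/

/-- Difference of positions as a sum of steps over an interval of bits. [folklore] -/
theorem pathPos_sub_pathPos (p : Cryptography.QReg n) {j₁ j₂ : ℕ} (h : j₁ ≤ j₂) :
    pathPos p j₂ - pathPos p j₁ =
      ∑ t ∈ Finset.univ.filter (fun t : Fin n => j₁ ≤ (t : ℕ) ∧ (t : ℕ) < j₂), stepSign (p t) := by
  unfold pathPos
  rw [add_sub_add_left_eq_sub, ← Finset.sum_sub_distrib, Finset.sum_filter]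
  refine Finset.sum_congr rfl fun t _ => ?_
  by_cases h1 : (t : ℕ) < j₁
  · have h2 : (t : ℕ) < j₂ := lt_of_lt_of_le h1 h
    simp [h1, h2, not_le.2 h1]
  · by_cases h2 : (t : ℕ) < j₂
    · simp [h1, h2, not_lt.1 h1]
    · simp [h1, h2]

namespace NCMatching

variable (M : NCMatching n)

/-- The steps strictly inside an arc cancel in pairs along `mate` when the string is compatible.
[cite: AharonovJonesLandau2009, §2.12] -/
theorem sum_stepSign_inside {p : Cryptography.QReg n} (hp : M.Compatible p) (a : Fin n) :
    ∑ t ∈ Finset.univ.filter (fun t : Fin n => (a : ℕ) + 1 ≤ (t : ℕ) ∧ (t : ℕ) < M.mate a),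
      stepSign (p t) = 0 := by
  refine Finset.sum_involution (fun t _ => M.mate t) ?_ ?_ ?_ ?_
  · intro t _
    rw [hp t, stepSign_not, add_neg_cancel]
  · intro t _ _
    exact M.mate_ne t
  · intro t ht
    simp only [Finset.mem_filter, Finset.mem_univ, true_and] at ht ⊢
    have h1 : a < t := Fin.lt_def.2 (by omega)
    have h2 : t < M.mate a := Fin.lt_def.2 ht.2
    have := M.nc a t h1 h2
    exact ⟨by have := Fin.lt_def.1 this.1; omega, Fin.lt_def.1 this.2⟩
  · intro t _
    exact M.mate_mate t

/-- **Positions around an arc of a compatible string**: outside the arc the walk returns to the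
vertex it started from, `z_a = z_{mate a + 1}`, and just inside it sits at one and the same
vertex, `z_{a+1} = z_{mate a}`. [cite: AharonovJonesLandau2009, §2.12 (compatible pairs label each region by a single vertex)] -/
theorem pathPos_arc {p : Cryptography.QReg n} (hp : M.Compatible p) (a : Fin n) (ha : a < M.mate a) :
    pathPos p (a + 1) = pathPos p (M.mate a) ∧ pathPos p a = pathPos p (M.mate a + 1) := by
  have hlt : (a : ℕ) < M.mate a := Fin.lt_def.1 ha
  have h1 : pathPos p (M.mate a) - pathPos p (a + 1) = 0 := by
    rw [pathPos_sub_pathPos p (by omega : (a : ℕ) + 1 ≤ M.mate a)]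
    exact M.sum_stepSign_inside hp a
  have hin : pathPos p (a + 1) = pathPos p (M.mate a) := by linarith
  refine ⟨hin, ?_⟩
  rw [pathPos_succ p (M.mate a).2, Fin.eta, hp a, stepSign_not, ← hin, pathPos_succ p a.2, Fin.eta]
  ring

end NCMatching

/-! ### Link-state vectors -/

/-- **The link-state vector of a non-crossing perfect matching** in the path-model register:
`v_M(p) = ∏_{a < mate a} √(λ_{z_{a+1}} / λ_{z_a})` for `p ∈ P_{n,k}` compatible with `M`
(`z_j = pathPos p j`), and `0` otherwise. The factor of an arc is AJL's cup weight `a_ℓ`/`b_ℓ`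
(§2.12, Claim 2.6) for outside vertex `ℓ = z_a` and inside vertex `z_{a+1} = ℓ ± 1`.
[cite: AharonovJonesLandau2009, §2.12 and Claim 2.6] -/
def linkVec (k : ℕ) (M : NCMatching n) (p : Cryptography.QReg n) : ℝ :=
  if IsGkPath k n p ∧ M.Compatible p then
    ∏ a ∈ M.lefts, Real.sqrt (ajlWeight k (pathPos p (a + 1)) / ajlWeight k (pathPos p a))
  else 0

/-- Entry formula of `linkVec` (definitional). [cite: AharonovJonesLandau2009, §2.12] -/
theorem linkVec_apply (k : ℕ) (M : NCMatching n) (p : Cryptography.QReg n) :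
    linkVec k M p = if IsGkPath k n p ∧ M.Compatible p then
      ∏ a ∈ M.lefts, Real.sqrt (ajlWeight k (pathPos p (a + 1)) / ajlWeight k (pathPos p a)) else 0 :=
  rfl

/-! ### The action of `Φ_i` on functions of the register: reduction to the two flips -/

section TwoFlips

variable {k : ℕ} {i : Fin (n - 1)}

/-- Row `q` of `Φ_i` is supported on the two flips of `q`. [folklore] -/
theorem ajlPhi_apply_eq_zero_of_ne_flipTo' {q p : Cryptography.QReg n} (h1 : p ≠ flipTo q i true)
    (h2 : p ≠ flipTo q i false) : ajlPhi k n i q p = 0 := by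
  rw [← ajlPhi_transpose, transpose_apply]
  exact ajlPhi_apply_eq_zero_of_ne_flipTo h1 h2

/-- `(Φ_i v)(q) = Φ_i(q, q♭1) v(q♭1) + Φ_i(q, q♭0) v(q♭0)`. [folklore] -/
theorem ajlPhi_mulVec_eq (v : Cryptography.QReg n → ℝ) (q : Cryptography.QReg n) :
    (ajlPhi k n i).mulVec v q =
      ajlPhi k n i q (flipTo q i true) * v (flipTo q i true) +
        ajlPhi k n i q (flipTo q i false) * v (flipTo q i false) := by
  rw [Matrix.mulVec, dotProduct,
    Fintype.sum_eq_add (flipTo q i true) (flipTo q i false) (flipTo_true_ne_false q i)]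
  rintro p ⟨h1, h2⟩
  rw [ajlPhi_apply_eq_zero_of_ne_flipTo' h1 h2, zero_mul]

/-- Off its support a row of `Φ_i` vanishes: `(Φ_i v)(q) = 0` unless `q ∈ P_{n,k}` reads `01` or
`10` at the bits `i, i+1`. [cite: AharonovJonesLandau2009, §3.1 eq. (3.1)] -/
theorem ajlPhi_mulVec_eq_zero (v : Cryptography.QReg n → ℝ) {q : Cryptography.QReg n}
    (hq : ¬ (IsGkPath k n q ∧ q (genFst i) ≠ q (genSnd i))) : (ajlPhi k n i).mulVec v q = 0 := by
  rw [Matrix.mulVec, dotProduct]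
  refine Finset.sum_eq_zero fun p _ => ?_
  rw [ajlPhi_apply, if_neg, zero_mul]
  exact fun h => hq ⟨h.2.1, h.2.2.2.2⟩

/-- The entry of `Φ_i` at `(q, q♭b)` for `q ∈ P_{n,k}` reading `01`/`10` at bits `i, i+1`:
`√(λ_{z+ε(q_i)} λ_{z+ε(b)})/λ_z` if the flip is a walk, `0` otherwise.
[cite: AharonovJonesLandau2009, §3.1 eq. (3.1)] -/
theorem ajlPhi_apply_flipTo {q : Cryptography.QReg n} (hq : IsGkPath k n q) (hne : q (genFst i) ≠ q (genSnd i))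
    (b : Bool) :
    ajlPhi k n i q (flipTo q i b) = if IsGkPath k n (flipTo q i b) then
      Real.sqrt (ajlWeight k (pathPos q i + stepSign (q (genFst i))) *
        ajlWeight k (pathPos q i + stepSign b)) / ajlWeight k (pathPos q i) else 0 := by
  by_cases hv : IsGkPath k n (flipTo q i b)
  · have hs : PhiSupport k n i q (flipTo q i b) :=
      ⟨hv, hq, fun t h1 h2 => (flipTo_of_ne q i b h1 h2).symm, by simp, hne⟩
    rw [ajlPhi_apply, if_pos hs, if_pos hv, pathPos_flipTo_of_le q i b le_rfl, flipTo_genFst,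
      mul_comm]
  · rw [if_neg hv, ajlPhi_apply, if_neg]
    exact fun h => hv h.1

/-- Positions of a flip of a string reading `01`/`10` at bits `i, i+1` agree with the original
ones at every index except `i + 1`. [folklore] -/
theorem pathPos_flipTo_of_ne (q : Cryptography.QReg n) (i : Fin (n - 1)) (b : Bool)
    (hq : q (genSnd i) = !q (genFst i)) {j : ℕ} (hj : j ≠ (i : ℕ) + 1) :
    pathPos (flipTo q i b) j = pathPos q j := by
  rcases Nat.lt_or_ge j (i + 1) with h | h
  · exact pathPos_flipTo_of_le q i b (by omega)
  · exact pathPos_flipTo_of_ge q i b hq (by omega)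

end TwoFlips

/-! ### L1: a capcup on a matched pair closes a loop, `Φ_i v_M = d v_M` -/

section L1

variable {k : ℕ} {i : Fin (n - 1)} (M : NCMatching n)

/-- Unequal bits at `i, i+1` means bit `i+1` is the negation of bit `i`. [folklore] -/
theorem snd_eq_not_fst_of_ne {q : Cryptography.QReg n} (h : q (genFst i) ≠ q (genSnd i)) :
    q (genSnd i) = !q (genFst i) := by
  cases h1 : q (genFst i) <;> cases h2 : q (genSnd i) <;> simp_all

/-- If `M` matches `i` with `i+1`, a compatible string reads `01` or `10` there. [folklore] -/
theorem NCMatching.Compatible.fst_ne_snd (hM : M.mate (genFst i) = genSnd i) {q : Cryptography.QReg n}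
    (hq : M.Compatible q) : q (genFst i) ≠ q (genSnd i) := by
  have := hq (genFst i)
  rw [hM] at this
  rw [this]
  cases q (genFst i) <;> simp

/-- If `M` matches `i` with `i+1`, compatibility of a flip at `i` is compatibility of the string
off the pair. [folklore] -/
theorem NCMatching.compatible_flipTo_iff (hM : M.mate (genFst i) = genSnd i) {q : Cryptography.QReg n}
    (hq : q (genSnd i) = !q (genFst i)) (b : Bool) : M.Compatible (flipTo q i b) ↔ M.Compatible q := by
  have hM' : M.mate (genSnd i) = genFst i := by rw [← hM, M.mate_mate]
  have key : ∀ t : Fin n, t ≠ genFst i → t ≠ genSnd i → M.mate t ≠ genFst i ∧ M.mate t ≠ genSnd i := by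
    intro t h1 h2
    constructor
    · intro h; apply h2; rw [← M.mate_mate t, h, hM]
    · intro h; apply h1; rw [← M.mate_mate t, h, hM']
  constructor
  · intro h t
    by_cases h1 : t = genFst i
    · subst h1; rw [hM, hq]
    · by_cases h2 : t = genSnd i
      · subst h2; rw [hM', hq, Bool.not_not]
      · have := h t
        rwa [flipTo_of_ne q i b h1 h2, flipTo_of_ne q i b (key t h1 h2).1 (key t h1 h2).2] at this
  · intro h t
    by_cases h1 : t = genFst i
    · subst h1; rw [hM]; simp
    · by_cases h2 : t = genSnd i
      · subst h2; rw [hM']; simp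
      · rw [flipTo_of_ne q i b h1 h2, flipTo_of_ne q i b (key t h1 h2).1 (key t h1 h2).2]
        exact h t

/-- The arc factors of a flip at a matched pair `(i, i+1)` agree with those of the string,
except for the arc `(i, i+1)` itself. [folklore] -/
theorem prod_lefts_erase_flipTo (hM : M.mate (genFst i) = genSnd i) {q : Cryptography.QReg n}
    (hq : q (genSnd i) = !q (genFst i)) (b : Bool) :
    ∏ a ∈ M.lefts.erase (genFst i),
        Real.sqrt (ajlWeight k (pathPos (flipTo q i b) (a + 1)) / ajlWeight k (pathPos (flipTo q i b) a)) =
      ∏ a ∈ M.lefts.erase (genFst i),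
        Real.sqrt (ajlWeight k (pathPos q (a + 1)) / ajlWeight k (pathPos q a)) := by
  refine Finset.prod_congr rfl fun a ha => ?_
  rw [Finset.mem_erase, NCMatching.mem_lefts] at ha
  have h1 : (a : ℕ) ≠ i := fun h => ha.1 (Fin.ext h)
  have h2 : (a : ℕ) ≠ i + 1 := by
    intro h
    have : a = genSnd i := Fin.ext h
    rw [this, ← hM, M.mate_mate, hM] at ha
    exact absurd (Fin.lt_def.1 ha.2) (by rw [genSnd_val, genFst_val]; omega)
  rw [pathPos_flipTo_of_ne q i b hq (by omega), pathPos_flipTo_of_ne q i b hq (by omega)]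

/-- **L1 (a capcup on a matched pair closes a loop): `Φ_i v_M = d · v_M` when `M(i) = i + 1`.**
With `z = z_i`, the two flips contribute `λ_{z±1} · (common factor)`, and
`λ_{z-1} + λ_{z+1} = d λ_z` (Claim 2.6). [cite: AharonovJonesLandau2009, Claim 2.4 (third relation, "one loop was created") and Claim 2.6] -/
theorem linkVec_closed (hk : 3 ≤ k) (hM : M.mate (genFst i) = genSnd i) :
    (ajlPhi k n i).mulVec (linkVec k M) = ajlLoopValue k • linkVec k M := by
  have _ := hk
  ext q
  rw [Pi.smul_apply, smul_eq_mul]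
  by_cases hq : IsGkPath k n q ∧ q (genFst i) ≠ q (genSnd i)
  · obtain ⟨hv, hne⟩ := hq
    have hsnd := snd_eq_not_fst_of_ne hne
    rw [ajlPhi_mulVec_eq, ajlPhi_apply_flipTo hv hne, ajlPhi_apply_flipTo hv hne]
    by_cases hc : M.Compatible q
    · -- the main computation
      have hmem : genFst i ∈ M.lefts := by
        rw [NCMatching.mem_lefts, hM]; exact Fin.lt_def.2 (by simp)
      have hz := hv.bounds (show (i : ℕ) ≤ n by omega)
      have hzpos := ajlWeight_pos hz
      have key := ajlWeight_pred_add_succ hz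
      -- unfold the three `linkVec`s and split off the arc `(i, i+1)`
      have e : ∀ b, linkVec k M (flipTo q i b) = if IsGkPath k n (flipTo q i b) then
          Real.sqrt (ajlWeight k (pathPos q i + stepSign b) / ajlWeight k (pathPos q i)) *
            ∏ a ∈ M.lefts.erase (genFst i),
              Real.sqrt (ajlWeight k (pathPos q (a + 1)) / ajlWeight k (pathPos q a)) else 0 := by
        intro b
        rw [linkVec_apply]
        by_cases hvb : IsGkPath k n (flipTo q i b)
        · rw [if_pos ⟨hvb, (M.compatible_flipTo_iff hM hsnd b).2 hc⟩, if_pos hvb,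
            ← Finset.mul_prod_erase _ _ hmem, genFst_val, prod_lefts_erase_flipTo M hM hsnd,
            pathPos_succ _ (by omega), show (⟨(i : ℕ), _⟩ : Fin n) = genFst i from rfl, flipTo_genFst,
            pathPos_flipTo_of_le q i b le_rfl]
        · rw [if_neg fun h => hvb h.1, if_neg hvb]
      have e0 : linkVec k M q =
          Real.sqrt (ajlWeight k (pathPos q i + stepSign (q (genFst i))) / ajlWeight k (pathPos q i)) *
            ∏ a ∈ M.lefts.erase (genFst i),
              Real.sqrt (ajlWeight k (pathPos q (a + 1)) / ajlWeight k (pathPos q a)) := by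
        rw [linkVec_apply, if_pos ⟨hv, hc⟩, ← Finset.mul_prod_erase _ _ hmem, genFst_val,
          pathPos_succ _ (by omega), show (⟨(i : ℕ), _⟩ : Fin n) = genFst i from rfl]
      rw [e, e, e0]
      -- each flip contributes `λ_{z+ε(b)} · C`
      set z := pathPos q i
      set R := ∏ a ∈ M.lefts.erase (genFst i),
        Real.sqrt (ajlWeight k (pathPos q (a + 1)) / ajlWeight k (pathPos q a))
      set x := ajlWeight k (z + stepSign (q (genFst i)))
      have hx : 0 ≤ x := ajlWeight_nonneg _ _
      have term : ∀ b, (if IsGkPath k n (flipTo q i b) then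
            Real.sqrt (x * ajlWeight k (z + stepSign b)) / ajlWeight k z else 0) *
          (if IsGkPath k n (flipTo q i b) then
            Real.sqrt (ajlWeight k (z + stepSign b) / ajlWeight k z) * R else 0) =
          ajlWeight k (z + stepSign b) * (Real.sqrt x / (ajlWeight k z * Real.sqrt (ajlWeight k z)) * R) := by
        intro b
        by_cases hvb : IsGkPath k n (flipTo q i b)
        · rw [if_pos hvb, if_pos hvb]
          have hy : 0 ≤ ajlWeight k (z + stepSign b) := ajlWeight_nonneg _ _
          rw [Real.sqrt_mul hx, Real.sqrt_div hy]
          have hsz : Real.sqrt (ajlWeight k z) ≠ 0 := (Real.sqrt_pos.2 hzpos).ne'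
          field_simp
          rw [Real.sq_sqrt hy]
          ring
        · rw [if_neg hvb, zero_mul, ajlWeight_eq_zero_of_not_isGkPath_flipTo hv hsnd hvb, zero_mul]
      rw [term, term, ← add_mul, stepSign_true, stepSign_false, ← sub_eq_add_neg, add_comm, key]
      have hsz : Real.sqrt (ajlWeight k z) ≠ 0 := (Real.sqrt_pos.2 hzpos).ne'
      rw [Real.sqrt_div hx]
      field_simp
    · -- incompatible: everything vanishes
      have h0 : ∀ b, linkVec k M (flipTo q i b) = 0 := fun b => by
        rw [linkVec_apply, if_neg]
        exact fun h => hc ((M.compatible_flipTo_iff hM hsnd b).1 h.2)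
      rw [h0, h0, mul_zero, mul_zero, add_zero, linkVec_apply, if_neg (fun h => hc h.2), mul_zero]
  · rw [ajlPhi_mulVec_eq_zero _ hq, linkVec_apply]
    by_cases h : IsGkPath k n q ∧ M.Compatible q
    · exact absurd ⟨h.1, h.2.fst_ne_snd M hM⟩ hq
    · rw [if_neg h, mul_zero]

end L1

/-! ### L3: the cup state of the plat closure is `(√d)^{n/2} |α⟩` -/

section L3

/-- In an even number of points, an even point is not the last one. [folklore] -/
theorem even_succ_lt_of_even (hn : Even n) {t : ℕ} (ht : t < n) (he : Even t) : t + 1 < n := by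
  obtain ⟨r, hr⟩ := hn; obtain ⟨u, hu⟩ := he; omega

/-- **The matching of the plat cups**, `2l ↔ 2l + 1` (`n` even). [cite: AharonovJonesLandau2009, Def. 2.8 (plat closure)] -/
def NCMatching.cups (hn : Even n) : NCMatching n where
  mate t := if h : Even (t : ℕ) then ⟨t + 1, even_succ_lt_of_even hn t.2 h⟩ else ⟨t - 1, by omega⟩
  mate_mate t := by
    rcases Nat.even_or_odd (t : ℕ) with h | h
    · have h' : ¬ Even ((t : ℕ) + 1) := by rw [Nat.even_add_one]; exact not_not.2 h
      ext; simp [h, h']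
    · have h1 : ¬ Even (t : ℕ) := Nat.not_even_iff_odd.2 h
      have h2 : 1 ≤ (t : ℕ) := by obtain ⟨u, hu⟩ := h; omega
      have h' : Even ((t : ℕ) - 1) := by
        obtain ⟨u, hu⟩ := h; exact ⟨u, by omega⟩
      ext; simp [h1, h', Nat.sub_add_cancel h2]
  mate_ne t := by
    rcases Nat.even_or_odd (t : ℕ) with h | h
    · simp [h, Fin.ext_iff]
    · have h1 : ¬ Even (t : ℕ) := Nat.not_even_iff_odd.2 h
      have h2 : 1 ≤ (t : ℕ) := by obtain ⟨u, hu⟩ := h; omega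
      simp [h1, Fin.ext_iff]; omega
  nc a t h1 h2 := by
    exfalso
    rcases Nat.even_or_odd (a : ℕ) with h | h
    · simp only [h, Fin.lt_def] at h2
      have := Fin.lt_def.1 h1
      simp at h2; omega
    · have h' : ¬ Even (a : ℕ) := Nat.not_even_iff_odd.2 h
      simp only [h', Fin.lt_def] at h2
      have := Fin.lt_def.1 h1
      simp at h2; omega

/-- The partner in the cup matching, on values. [folklore] -/
theorem NCMatching.cups_mate_val (hn : Even n) (t : Fin n) :
    (((NCMatching.cups hn).mate t : Fin n) : ℕ) = if Even (t : ℕ) then (t : ℕ) + 1 else (t : ℕ) - 1 := by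
  simp only [NCMatching.cups]
  split_ifs <;> rfl

/-- The left endpoints of the cup matching are the even points. [folklore] -/
theorem NCMatching.mem_lefts_cups (hn : Even n) (t : Fin n) :
    t ∈ (NCMatching.cups hn).lefts ↔ Even (t : ℕ) := by
  rw [NCMatching.mem_lefts, Fin.lt_def, NCMatching.cups_mate_val]
  split_ifs with h
  · simp [h]
  · simp [h]

/-- There are `n/2` cups. [folklore] -/
theorem NCMatching.card_lefts_cups (hn : Even n) : (NCMatching.cups hn).lefts.card = n / 2 := by
  have : (NCMatching.cups hn).lefts = Finset.univ.image
      (fun l : Fin (n / 2) => (⟨2 * (l : ℕ), by have := l.2; omega⟩ : Fin n)) := by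
    ext t
    rw [NCMatching.mem_lefts_cups, Finset.mem_image]
    constructor
    · rintro ⟨u, hu⟩
      refine ⟨⟨u, by have := t.2; obtain ⟨r, hr⟩ := hn; omega⟩, Finset.mem_univ _, Fin.ext ?_⟩
      simp; omega
    · rintro ⟨l, -, rfl⟩
      exact ⟨l, by simp; ring⟩
  rw [this, Finset.card_image_of_injective _ fun l l' h => by
    have := Fin.ext_iff.1 h; exact Fin.ext (by simp at this; omega)]
  simp

/-- A walk of `P_{n,k}` compatible with the cups is the zigzag `α`. [cite: AharonovJonesLandau2009, Claim 3.8 (proof)] -/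
theorem eq_ajlAlpha_of_compatible_cups {k : ℕ} (hn : Even n) {p : Cryptography.QReg n} (hp : IsGkPath k n p)
    (hc : (NCMatching.cups hn).Compatible p) : p = ajlAlpha n := by
  -- by induction on `l`: the first `2l` bits of `p` are those of `α`
  have key : ∀ l, 2 * l ≤ n → ∀ t : Fin n, (t : ℕ) < 2 * l → p t = decide (Even (t : ℕ)) := by
    intro l
    induction l with
    | zero => intro _ t ht; omega
    | succ l ih =>
      intro hl t ht
      have ih' := ih (by omega)
      have h2l : 2 * l < n := by omega
      -- bit `2l` is a step to the right (the walk is at vertex `1`), bit `2l+1` its negation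
      have hz : pathPos p (2 * l) = 1 := pathPos_of_altPrefix ih' (by omega)
      have h0 : p ⟨2 * l, h2l⟩ = true := eq_true_of_isGkPath hp h2l hz
      have h1 : p ⟨2 * l + 1, by omega⟩ = false := by
        have := hc ⟨2 * l, h2l⟩
        simp only [NCMatching.cups, even_two_mul] at this
        rw [h0] at this
        exact this
      rcases Nat.lt_or_ge t (2 * l) with h | h
      · exact ih' t h
      · rcases Nat.lt_or_ge t (2 * l + 1) with h' | h'
        · have : t = ⟨2 * l, h2l⟩ := Fin.ext (by simp; omega)
          rw [this, h0]; simp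
        · have : t = ⟨2 * l + 1, by omega⟩ := Fin.ext (by simp; omega)
          rw [this, h1]; simp
  funext t
  exact key (n / 2) (Nat.mul_div_le n 2) t (by have := t.2; obtain ⟨r, hr⟩ := hn; omega)

/-- `α` is compatible with the cups. [cite: AharonovJonesLandau2009, Claim 3.8 (proof)] -/
theorem compatible_cups_ajlAlpha (hn : Even n) : (NCMatching.cups hn).Compatible (ajlAlpha n) := by
  intro t
  simp only [ajlAlpha]
  have hv := NCMatching.cups_mate_val hn t
  by_cases h : Even (t : ℕ)
  · rw [if_pos h] at hv
    have : Even (((NCMatching.cups hn).mate t : Fin n) : ℕ) ↔ ¬ Even (t : ℕ) := by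
      rw [hv, Nat.even_add_one]
    simp [this, h]
  · rw [if_neg h] at hv
    have h2 : 1 ≤ (t : ℕ) := by
      rcases Nat.even_or_odd (t : ℕ) with h' | ⟨u, hu⟩
      · exact absurd h' h
      · omega
    have : Even (((NCMatching.cups hn).mate t : Fin n) : ℕ) ↔ ¬ Even (t : ℕ) := by
      rw [hv]
      constructor
      · intro he ht
        obtain ⟨u, hu⟩ := he; obtain ⟨v, hv⟩ := ht; omega
      · intro ht
        rcases Nat.even_or_odd (t : ℕ) with h' | ⟨u, hu⟩
        · exact absurd h' ht
        · exact ⟨u, by omega⟩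
    simp [this, h]

/-- **L3: the link state of the plat cups is `(√d)^{n/2} |α⟩`** (`k ≥ 3`: each cup sits between
the vertices `1` (outside) and `2` (inside) and carries `√(λ₂/λ₁) = √d`).
[cite: AharonovJonesLandau2009, Claim 3.8 and Claim 2.6] -/
theorem linkVec_cups {k : ℕ} (hk : 3 ≤ k) (hn : Even n) (p : Cryptography.QReg n) :
    linkVec k (NCMatching.cups hn) p =
      if p = ajlAlpha n then Real.sqrt (ajlLoopValue k) ^ (n / 2) else 0 := by
  rw [linkVec_apply]
  by_cases hp : p = ajlAlpha n
  · subst hp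
    rw [if_pos ⟨isGkPath_ajlAlpha hk n, compatible_cups_ajlAlpha hn⟩, if_pos rfl,
      ← NCMatching.card_lefts_cups hn, ← Finset.prod_const]
    refine Finset.prod_congr rfl fun a ha => ?_
    rw [NCMatching.mem_lefts_cups] at ha
    obtain ⟨l, hl⟩ := ha
    have hl' : (a : ℕ) = 2 * l := by omega
    have h2l : 2 * l < n := hl' ▸ a.2
    have hz : pathPos (ajlAlpha n) (2 * l) = 1 := pathPos_of_altPrefix (fun t _ => rfl) h2l.le
    have hz1 : pathPos (ajlAlpha n) (2 * l + 1) = 1 + 1 := by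
      rw [pathPos_succ _ h2l, hz]
      simp [ajlAlpha]
    rw [hl', hz1, hz]
    have h1 : (1 : ℤ) ≤ 1 ∧ (1 : ℤ) + 1 ≤ k := ⟨le_rfl, by omega⟩
    have key := ajlWeight_pred_add_succ h1
    rw [ajlWeight_of_not (by omega), zero_add] at key
    rw [key, mul_div_assoc, div_self (ajlWeight_pos h1).ne', mul_one]
  · rw [if_neg hp, if_neg]
    exact fun h => hp (eq_ajlAlpha_of_compatible_cups hn h.1 h.2)

end L3

/-! ### Splicing a matching by a capcup -/

section Splice

namespace NCMatching

variable (M : NCMatching n) (i : Fin (n - 1))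

/-- The partner function after the capcup `E_i` has been put on top of a cap state with matching
`M` in which `i` and `i+1` are NOT partners: `i ↔ i+1` (the new cup) and
`mate i ↔ mate (i+1)` (the cap joins the two strands), all other pairs unchanged.
[cite: AharonovJonesLandau2009, Def. 2.5 (multiplication of Kauffman diagrams)] -/
def spliceMate (t : Fin n) : Fin n :=
  if t = genFst i then genSnd i else if t = genSnd i then genFst i
  else if t = M.mate (genFst i) then M.mate (genSnd i)
  else if t = M.mate (genSnd i) then M.mate (genFst i) else M.mate t

variable {M i}

/-- `mate (i+1) ≠ i` when `mate i ≠ i+1`. [folklore] -/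
theorem mate_snd_ne_fst (h : M.mate (genFst i) ≠ genSnd i) : M.mate (genSnd i) ≠ genFst i :=
  fun h' => h (by rw [← h', M.mate_mate])

/-- `mate i ≠ mate (i+1)`. [folklore] -/
theorem mate_fst_ne_mate_snd : M.mate (genFst i) ≠ M.mate (genSnd i) :=
  fun h' => genFst_ne_genSnd i (M.mate_injective h')

/-- `spliceMate i = i+1`. [folklore] -/
theorem spliceMate_fst : M.spliceMate i (genFst i) = genSnd i := by simp [spliceMate]

/-- `spliceMate (i+1) = i`. [folklore] -/
theorem spliceMate_snd : M.spliceMate i (genSnd i) = genFst i := by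
  simp [spliceMate, (genFst_ne_genSnd i).symm]

/-- `spliceMate (mate i) = mate (i+1)`. [folklore] -/
theorem spliceMate_mate_fst (h : M.mate (genFst i) ≠ genSnd i) :
    M.spliceMate i (M.mate (genFst i)) = M.mate (genSnd i) := by
  simp [spliceMate, M.mate_ne, h]

/-- `spliceMate (mate (i+1)) = mate i`. [folklore] -/
theorem spliceMate_mate_snd (h : M.mate (genFst i) ≠ genSnd i) :
    M.spliceMate i (M.mate (genSnd i)) = M.mate (genFst i) := by
  simp [spliceMate, M.mate_ne, mate_snd_ne_fst h, (mate_fst_ne_mate_snd (M := M) (i := i)).symm]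

/-- `spliceMate` agrees with `mate` off the four special points. [folklore] -/
theorem spliceMate_of_ne {t : Fin n} (h1 : t ≠ genFst i) (h2 : t ≠ genSnd i)
    (h3 : t ≠ M.mate (genFst i)) (h4 : t ≠ M.mate (genSnd i)) : M.spliceMate i t = M.mate t := by
  simp [spliceMate, h1, h2, h3, h4]

/-- Off the four special points, `mate` avoids the four special points. [folklore] -/
theorem mate_not_special {t : Fin n} (h1 : t ≠ genFst i) (h2 : t ≠ genSnd i)
    (h3 : t ≠ M.mate (genFst i)) (h4 : t ≠ M.mate (genSnd i)) :
    M.mate t ≠ genFst i ∧ M.mate t ≠ genSnd i ∧ M.mate t ≠ M.mate (genFst i) ∧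
      M.mate t ≠ M.mate (genSnd i) := by
  refine ⟨fun e => h3 ?_, fun e => h4 ?_, fun e => h1 (M.mate_injective e),
    fun e => h2 (M.mate_injective e)⟩
  · rw [← e, M.mate_mate]
  · rw [← e, M.mate_mate]

/-- `spliceMate` is an involution. [folklore] -/
theorem spliceMate_spliceMate (h : M.mate (genFst i) ≠ genSnd i) (t : Fin n) :
    M.spliceMate i (M.spliceMate i t) = t := by
  by_cases h1 : t = genFst i
  · rw [h1, spliceMate_fst, spliceMate_snd]
  by_cases h2 : t = genSnd i
  · rw [h2, spliceMate_snd, spliceMate_fst]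
  by_cases h3 : t = M.mate (genFst i)
  · rw [h3, spliceMate_mate_fst h, spliceMate_mate_snd h]
  by_cases h4 : t = M.mate (genSnd i)
  · rw [h4, spliceMate_mate_snd h, spliceMate_mate_fst h]
  obtain ⟨k1, k2, k3, k4⟩ := mate_not_special h1 h2 h3 h4
  rw [spliceMate_of_ne h1 h2 h3 h4, spliceMate_of_ne k1 k2 k3 k4, M.mate_mate]

/-- `spliceMate` has no fixed point. [folklore] -/
theorem spliceMate_ne (h : M.mate (genFst i) ≠ genSnd i) (t : Fin n) : M.spliceMate i t ≠ t := by
  by_cases h1 : t = genFst i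
  · rw [h1, spliceMate_fst]; exact (genFst_ne_genSnd i).symm
  by_cases h2 : t = genSnd i
  · rw [h2, spliceMate_snd]; exact genFst_ne_genSnd i
  by_cases h3 : t = M.mate (genFst i)
  · rw [h3, spliceMate_mate_fst h]; exact (mate_fst_ne_mate_snd (M := M) (i := i)).symm
  by_cases h4 : t = M.mate (genSnd i)
  · rw [h4, spliceMate_mate_snd h]; exact mate_fst_ne_mate_snd
  rw [spliceMate_of_ne h1 h2 h3 h4]; exact M.mate_ne t

/-- Non-crossing on values, as used below. [folklore] -/
theorem nc_val (a t : Fin n) (h1 : (a : ℕ) < t) (h2 : (t : ℕ) < M.mate a) :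
    (a : ℕ) < M.mate t ∧ (M.mate t : ℕ) < M.mate a :=
  let ⟨x, y⟩ := M.nc a t (Fin.lt_def.2 h1) (Fin.lt_def.2 h2)
  ⟨Fin.lt_def.1 x, Fin.lt_def.1 y⟩

/-- **Non-crossing is preserved by splicing.** The open interval of an old arc is stable under
`mate` and under `i ↔ i+1`, hence under `mate i ↔ mate (i+1)`; the new arc `{mate i, mate (i+1)}`
spans the two old arcs through `i`, `i+1` (three configurations: side by side, or nested either
way). [cite: AharonovJonesLandau2009, Def. 2.5 (the product of Kauffman diagrams is a Kauffman diagram)] -/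
theorem spliceMate_nc (h : M.mate (genFst i) ≠ genSnd i) (a t : Fin n) (hat : a < t)
    (htm : t < M.spliceMate i a) : a < M.spliceMate i t ∧ M.spliceMate i t < M.spliceMate i a := by
  have vne : ∀ {x y : Fin n}, x ≠ y → (x : ℕ) ≠ y := fun hxy hv => hxy (Fin.ext hv)
  -- arithmetic of the four special points `i₀ = i`, `i₁ = i+1`, `c = mate i₀`, `e = mate i₁`
  have hv : ((genSnd i : Fin n) : ℕ) = (genFst i : ℕ) + 1 := by simp
  have hc0 := vne (M.mate_ne (genFst i))
  have hc1 := vne h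
  have he1 := vne (M.mate_ne (genSnd i))
  have he0 := vne (mate_snd_ne_fst h)
  have hce := vne (mate_fst_ne_mate_snd (M := M) (i := i))
  have hmc : M.mate (M.mate (genFst i)) = genFst i := M.mate_mate _
  have hme : M.mate (M.mate (genSnd i)) = genSnd i := M.mate_mate _
  simp only [Fin.lt_def] at hat htm ⊢
  -- (1) closure of an old arc `(a', mate a')` under `spliceMate`
  have old_arc : ∀ a' : Fin n, a' ≠ genFst i → a' ≠ genSnd i → a' ≠ M.mate (genFst i) →
      a' ≠ M.mate (genSnd i) → ∀ t' : Fin n, (a' : ℕ) < t' → (t' : ℕ) < M.mate a' →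
      (a' : ℕ) < M.spliceMate i t' ∧ (M.spliceMate i t' : ℕ) < M.mate a' := by
    intro a' h1 h2 h3 h4 t' h5 h6
    obtain ⟨k1, k2, k3, k4⟩ := mate_not_special h1 h2 h3 h4
    have i0_to_i1 : (a' : ℕ) < genFst i → ((genFst i : Fin n) : ℕ) < M.mate a' →
        (a' : ℕ) < genSnd i ∧ ((genSnd i : Fin n) : ℕ) < M.mate a' :=
      fun x y => ⟨by omega, by have := vne k2; omega⟩
    have i1_to_i0 : (a' : ℕ) < genSnd i → ((genSnd i : Fin n) : ℕ) < M.mate a' →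
        (a' : ℕ) < genFst i ∧ ((genFst i : Fin n) : ℕ) < M.mate a' :=
      fun x y => ⟨by have := vne h1; omega, by omega⟩
    by_cases e1 : t' = genFst i
    · rw [e1, spliceMate_fst]; rw [e1] at h5 h6; exact i0_to_i1 h5 h6
    by_cases e2 : t' = genSnd i
    · rw [e2, spliceMate_snd]; rw [e2] at h5 h6; exact i1_to_i0 h5 h6
    by_cases e3 : t' = M.mate (genFst i)
    · rw [e3, spliceMate_mate_fst h]; rw [e3] at h5 h6
      obtain ⟨x, y⟩ := M.nc_val a' _ h5 h6; rw [hmc] at x y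
      obtain ⟨x, y⟩ := i0_to_i1 x y
      exact M.nc_val a' _ x y
    by_cases e4 : t' = M.mate (genSnd i)
    · rw [e4, spliceMate_mate_snd h]; rw [e4] at h5 h6
      obtain ⟨x, y⟩ := M.nc_val a' _ h5 h6; rw [hme] at x y
      obtain ⟨x, y⟩ := i1_to_i0 x y
      exact M.nc_val a' _ x y
    rw [spliceMate_of_ne e1 e2 e3 e4]
    exact M.nc_val a' t' h5 h6
  -- (2) case analysis on `a`
  by_cases a1 : a = genFst i
  · rw [a1, spliceMate_fst] at htm; rw [a1] at hat; omega
  by_cases a2 : a = genSnd i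
  · rw [a2, spliceMate_snd] at htm; rw [a2] at hat; omega
  by_cases a3 : a = M.mate (genFst i)
  · -- the new arc seen from `c = mate i`: partner `e = mate (i+1)`; `c < t < e` forces `c < i < i+1 < e`
    rw [a3, spliceMate_mate_fst h] at htm ⊢; rw [a3] at hat
    have hci : ((M.mate (genFst i) : Fin n) : ℕ) < genFst i := by
      by_contra hh
      have hi1c : ((genSnd i : Fin n) : ℕ) < M.mate (genFst i) := by omega
      -- `c` inside `(i+1, e)` would put `mate c = i` inside it
      obtain ⟨y, -⟩ := M.nc_val (genSnd i) (M.mate (genFst i)) hi1c (by omega)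
      rw [hmc] at y
      omega
    have hie : ((genSnd i : Fin n) : ℕ) < M.mate (genSnd i) := by
      by_contra hh
      have hei : ((M.mate (genSnd i) : Fin n) : ℕ) < genFst i := by omega
      -- `e` inside `(c, i)` would put `mate e = i+1` inside it
      rcases Nat.lt_or_ge ((M.mate (genFst i) : Fin n) : ℕ) (M.mate (genSnd i)) with x | x
      · obtain ⟨-, y⟩ := M.nc_val (M.mate (genFst i)) (M.mate (genSnd i)) x (by rw [hmc]; exact hei)
        rw [hme, hmc] at y
        omega
      · omega
    by_cases e1 : t = genFst i
    · rw [e1, spliceMate_fst]; omega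
    by_cases e2 : t = genSnd i
    · rw [e2, spliceMate_snd]; omega
    have e3 : t ≠ M.mate (genFst i) := fun hh => by rw [hh] at hat; omega
    have e4 : t ≠ M.mate (genSnd i) := fun hh => by rw [hh] at htm; omega
    rw [spliceMate_of_ne e1 e2 e3 e4]
    rcases Nat.lt_or_ge (t : ℕ) (genFst i) with x | x
    · obtain ⟨y1, y2⟩ := M.nc_val (M.mate (genFst i)) t hat (by rw [hmc]; exact x)
      rw [hmc] at y2
      omega
    · have x' : ((genSnd i : Fin n) : ℕ) < t := by have := vne e1; have := vne e2; omega
      obtain ⟨y1, y2⟩ := M.nc_val (genSnd i) t x' htm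
      omega
  by_cases a4 : a = M.mate (genSnd i)
  · -- the new arc seen from `e = mate (i+1)`: partner `c`; `e < t < c`
    rw [a4, spliceMate_mate_snd h] at htm ⊢; rw [a4] at hat
    -- `i+1 ∉ (e, c)` and `i ∉ (e, c)`:
    have key0 : ¬ (((M.mate (genSnd i) : Fin n) : ℕ) < genFst i ∧
        ((genFst i : Fin n) : ℕ) < M.mate (genFst i)) := by
      rintro ⟨x1, x2⟩
      -- `i` inside `(e, i+1)` ⇒ `mate i = c` inside `(e, i+1)`, contradicting `i < c`? no: gives `c < i+1`
      obtain ⟨-, y⟩ := M.nc_val (M.mate (genSnd i)) (genFst i) x1 (by rw [hme]; omega)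
      rw [hme] at y
      omega
    have e1 : t ≠ genFst i := fun hh => key0 (by rw [hh] at hat htm; exact ⟨hat, htm⟩)
    have e2 : t ≠ genSnd i := by
      intro hh; rw [hh] at hat htm
      exact key0 ⟨by omega, by omega⟩
    have e4 : t ≠ M.mate (genSnd i) := fun hh => by rw [hh] at hat; omega
    have e3 : t ≠ M.mate (genFst i) := fun hh => by rw [hh] at htm; omega
    rw [spliceMate_of_ne e1 e2 e3 e4]
    have n1 : M.mate t ≠ M.mate (genSnd i) := fun hh' => e2 (M.mate_injective hh')
    have n2 : M.mate t ≠ genFst i := fun hh' => e3 (by rw [← M.mate_mate t, hh'])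
    have n3 : M.mate t ≠ genSnd i := fun hh' => e4 (by rw [← M.mate_mate t, hh'])
    have n4 : M.mate t ≠ M.mate (genFst i) := fun hh' => e1 (M.mate_injective hh')
    rcases Nat.lt_or_ge ((M.mate (genFst i) : Fin n) : ℕ) (genFst i) with x | x
    · -- configuration `e < c < i < i+1`: `t` inside `(e, i+1)`
      obtain ⟨y1, y2⟩ := M.nc_val (M.mate (genSnd i)) t hat (by rw [hme]; omega)
      rw [hme] at y2
      refine ⟨y1, ?_⟩
      by_contra hh
      have z1 : ((M.mate (genFst i) : Fin n) : ℕ) < M.mate t := by have := vne n4; omega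
      have z2 : ((M.mate t : Fin n) : ℕ) < genFst i := by have := vne n2; omega
      obtain ⟨w, -⟩ := M.nc_val (M.mate (genFst i)) (M.mate t) z1 (by rw [hmc]; exact z2)
      rw [M.mate_mate] at w
      omega
    · -- configuration `i < i+1 < e < c`: `t` inside `(i, c)`
      have x' : ((genSnd i : Fin n) : ℕ) < M.mate (genSnd i) := by
        by_contra hh
        exact key0 ⟨by omega, by omega⟩
      obtain ⟨y1, y2⟩ := M.nc_val (genFst i) t (by omega) htm
      refine ⟨?_, y2⟩
      by_contra hh
      have z1 : ((genSnd i : Fin n) : ℕ) < M.mate t := by have := vne n2; have := vne n3; omega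
      have z2 : ((M.mate t : Fin n) : ℕ) < M.mate (genSnd i) := by have := vne n1; omega
      obtain ⟨-, w⟩ := M.nc_val (genSnd i) (M.mate t) z1 z2
      rw [M.mate_mate] at w
      omega
  -- an old arc
  rw [spliceMate_of_ne a1 a2 a3 a4] at htm ⊢
  exact old_arc a a1 a2 a3 a4 t hat htm

/-- **The spliced matching** `M ⋆ i` (for `M(i) ≠ i + 1`). [cite: AharonovJonesLandau2009, Def. 2.5] -/
def splice (M : NCMatching n) (i : Fin (n - 1)) (h : M.mate (genFst i) ≠ genSnd i) : NCMatching n where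
  mate := M.spliceMate i
  mate_mate := spliceMate_spliceMate h
  mate_ne := spliceMate_ne h
  nc := spliceMate_nc h

end NCMatching

end Splice

/-! ### L2: a capcup on two different strands splices the matching, `Φ_i v_M = v_{M ⋆ i}` -/

section L2

variable {k : ℕ} {i : Fin (n - 1)} (M : NCMatching n)

/-- The factor of the point `a` in `v_M(p)`: the arc weight if `a` is a left endpoint, else `1`.
[cite: AharonovJonesLandau2009, §2.12] -/
def arcFactor (k : ℕ) (M : NCMatching n) (p : Cryptography.QReg n) (a : Fin n) : ℝ :=
  if a < M.mate a then Real.sqrt (ajlWeight k (pathPos p (a + 1)) / ajlWeight k (pathPos p a)) else 1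

/-- `v_M(p)` as a product over all points. [cite: AharonovJonesLandau2009, §2.12] -/
theorem linkVec_eq_prod_arcFactor (k : ℕ) (M : NCMatching n) (p : Cryptography.QReg n) :
    linkVec k M p = if IsGkPath k n p ∧ M.Compatible p then ∏ a, arcFactor k M p a else 0 := by
  rw [linkVec_apply]
  split_ifs
  · rw [NCMatching.lefts, Finset.prod_filter]; rfl
  · rfl

/-- Peeling four distinct points off a product over `Fin n`. [folklore] -/
theorem prod_univ_peel4 (f : Fin n → ℝ) {a b c d : Fin n} (hab : a ≠ b) (hac : a ≠ c) (had : a ≠ d)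
    (hbc : b ≠ c) (hbd : b ≠ d) (hcd : c ≠ d) :
    ∏ x, f x = f a * f b * f c * f d *
      ∏ x ∈ (((Finset.univ.erase a).erase b).erase c).erase d, f x := by
  have hb : b ∈ Finset.univ.erase a := by simp [hab.symm]
  have hc : c ∈ (Finset.univ.erase a).erase b := by simp [hac.symm, hbc.symm]
  have hd : d ∈ ((Finset.univ.erase a).erase b).erase c := by simp [had.symm, hbd.symm, hcd.symm]
  rw [← Finset.mul_prod_erase _ _ (Finset.mem_univ a), ← Finset.mul_prod_erase _ _ hb,
    ← Finset.mul_prod_erase _ _ hc, ← Finset.mul_prod_erase _ _ hd]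
  ring

/-- Membership in the four-fold erasure. [folklore] -/
theorem mem_erase4 {a b c d x : Fin n} :
    x ∈ (((Finset.univ.erase a).erase b).erase c).erase d ↔ x ≠ a ∧ x ≠ b ∧ x ≠ c ∧ x ≠ d := by
  simp [and_assoc, and_comm]

namespace NCMatching

variable {M}

/-- Compatibility of a flip at `i` with `M`, when `M(i) ≠ i+1`: off the four special points it is
that of the string, and the new bits must oppose the bits at `mate i`, `mate (i+1)`. [folklore] -/
theorem compatible_flipTo_iff_of_ne (h : M.mate (genFst i) ≠ genSnd i) {q : Cryptography.QReg n} (b : Bool) :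
    M.Compatible (flipTo q i b) ↔
      (∀ t : Fin n, t ≠ genFst i → t ≠ genSnd i → t ≠ M.mate (genFst i) → t ≠ M.mate (genSnd i) →
        q (M.mate t) = !q t) ∧ b = !q (M.mate (genFst i)) ∧ b = q (M.mate (genSnd i)) := by
  have hc0 : M.mate (genFst i) ≠ genFst i := M.mate_ne _
  have he1 : M.mate (genSnd i) ≠ genSnd i := M.mate_ne _
  have he0 : M.mate (genSnd i) ≠ genFst i := mate_snd_ne_fst h
  constructor
  · intro hc
    refine ⟨fun t h1 h2 h3 h4 => ?_, ?_, ?_⟩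
    · obtain ⟨k1, k2, -, -⟩ := mate_not_special h1 h2 h3 h4
      have := hc t
      rwa [flipTo_of_ne q i b k1 k2, flipTo_of_ne q i b h1 h2] at this
    · have := hc (genFst i)
      rw [flipTo_of_ne q i b hc0 h, flipTo_genFst] at this
      rw [this, Bool.not_not]
    · have := hc (genSnd i)
      rw [flipTo_of_ne q i b he0 he1, flipTo_genSnd] at this
      rw [this, Bool.not_not]
  · rintro ⟨hr, hb1, hb2⟩ t
    by_cases h1 : t = genFst i
    · rw [h1, flipTo_of_ne q i b hc0 h, flipTo_genFst, hb1, Bool.not_not]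
    by_cases h2 : t = genSnd i
    · rw [h2, flipTo_of_ne q i b he0 he1, flipTo_genSnd, hb2, Bool.not_not]
    by_cases h3 : t = M.mate (genFst i)
    · rw [h3, M.mate_mate, flipTo_genFst, flipTo_of_ne q i b hc0 h, hb1]
    by_cases h4 : t = M.mate (genSnd i)
    · rw [h4, M.mate_mate, flipTo_genSnd, flipTo_of_ne q i b he0 he1, hb2]
    obtain ⟨k1, k2, -, -⟩ := mate_not_special h1 h2 h3 h4
    rw [flipTo_of_ne q i b k1 k2, flipTo_of_ne q i b h1 h2]
    exact hr t h1 h2 h3 h4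

/-- Compatibility with the spliced matching: off the four special points it is that of the string,
plus `q (i+1) = ¬ q i` and `q (mate (i+1)) = ¬ q (mate i)`. [folklore] -/
theorem compatible_splice_iff (h : M.mate (genFst i) ≠ genSnd i) {q : Cryptography.QReg n} :
    (M.splice i h).Compatible q ↔
      (∀ t : Fin n, t ≠ genFst i → t ≠ genSnd i → t ≠ M.mate (genFst i) → t ≠ M.mate (genSnd i) →
        q (M.mate t) = !q t) ∧ q (genSnd i) = !q (genFst i) ∧
        q (M.mate (genSnd i)) = !q (M.mate (genFst i)) := by
  change (∀ t, q (M.spliceMate i t) = !q t) ↔ _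
  constructor
  · intro hc
    refine ⟨fun t h1 h2 h3 h4 => ?_, ?_, ?_⟩
    · rw [← spliceMate_of_ne h1 h2 h3 h4]; exact hc t
    · rw [← spliceMate_fst (M := M)]; exact hc _
    · rw [← spliceMate_mate_fst h]; exact hc _
  · rintro ⟨hr, h01, hce⟩ t
    by_cases h1 : t = genFst i
    · rw [h1, spliceMate_fst, h01]
    by_cases h2 : t = genSnd i
    · rw [h2, spliceMate_snd, h01, Bool.not_not]
    by_cases h3 : t = M.mate (genFst i)
    · rw [h3, spliceMate_mate_fst h, hce]
    by_cases h4 : t = M.mate (genSnd i)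
    · rw [h4, spliceMate_mate_snd h, hce, Bool.not_not]
    rw [spliceMate_of_ne h1 h2 h3 h4]
    exact hr t h1 h2 h3 h4

end NCMatching

/-- Off the four special points the arc factors of `M` at the flip and of `M ⋆ i` at the string
agree. [folklore] -/
theorem arcFactor_splice_of_ne (h : M.mate (genFst i) ≠ genSnd i) {q : Cryptography.QReg n}
    (hsnd : q (genSnd i) = !q (genFst i)) (b : Bool) {a : Fin n} (h1 : a ≠ genFst i)
    (h2 : a ≠ genSnd i) (h3 : a ≠ M.mate (genFst i)) (h4 : a ≠ M.mate (genSnd i)) :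
    arcFactor k M (flipTo q i b) a = arcFactor k (M.splice i h) q a := by
  have hm : (M.splice i h).mate a = M.mate a := NCMatching.spliceMate_of_ne h1 h2 h3 h4
  have ha1 : (a : ℕ) ≠ (i : ℕ) + 1 := fun e => h2 (Fin.ext (by simp [e]))
  have ha2 : (a : ℕ) + 1 ≠ (i : ℕ) + 1 := fun e => h1 (Fin.ext (by simp at e; simp [e]))
  simp only [arcFactor, hm, pathPos_flipTo_of_ne q i b hsnd ha1, pathPos_flipTo_of_ne q i b hsnd ha2]

/-- Two steps that cancel: `z_{i+2} = z_i` for a string reading `01`/`10` at `i, i+1`. [folklore] -/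
theorem pathPos_add_two {q : Cryptography.QReg n} {i : Fin (n - 1)} (hsnd : q (genSnd i) = !q (genFst i)) :
    pathPos q ((i : ℕ) + 1 + 1) = pathPos q i := by
  rw [pathPos_succ q (by omega : (i : ℕ) + 1 < n), pathPos_succ q (by omega : (i : ℕ) < n),
    show (⟨(i : ℕ) + 1, _⟩ : Fin n) = genSnd i from rfl, show (⟨(i : ℕ), _⟩ : Fin n) = genFst i from rfl,
    hsnd, stepSign_not]
  ring

/-- The algebra of L2: with `x = λ_{z+ε(q_i)}`, `w = λ_{z'}`, `λ = λ_z > 0`, `w > 0`,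
`(√(x w)/λ) · √(λ/w) = √(x/λ)` and `√(λ/w) · √(w/λ) = 1`. [folklore] -/
theorem l2_algebra {x w l : ℝ} (hx : 0 ≤ x) (hw : 0 < w) (hl : 0 < l) :
    Real.sqrt (x * w) / l * Real.sqrt (l / w) = Real.sqrt (x / l) ∧
      Real.sqrt (l / w) * Real.sqrt (w / l) = 1 := by
  have hsw : Real.sqrt w ≠ 0 := (Real.sqrt_pos.2 hw).ne'
  have hsl : Real.sqrt l ≠ 0 := (Real.sqrt_pos.2 hl).ne'
  constructor
  · rw [Real.sqrt_mul hx, Real.sqrt_div hl.le, Real.sqrt_div hx]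
    field_simp
    rw [Real.sq_sqrt hl.le]
  · rw [Real.sqrt_div hl.le, Real.sqrt_div hw.le]
    field_simp

/-- **L2, the main computation.** For `q ∈ P_{n,k}` reading `01`/`10` at `i, i+1`, compatible with
`M` off the special points and with `q (mate (i+1)) = ¬ q (mate i)`, the flip `q♭` with new bit
`q (mate (i+1))` at `i` is the unique `M`-compatible flip, and
`Φ_i(q, q♭) v_M(q♭) = v_{M ⋆ i}(q)`: in each of the three configurations of the two arcs through
`i`, `i+1` the weights of those arcs, the entry of `Φ_i` and the weights of the new arcs
`(i, i+1)`, `{mate i, mate (i+1)}` match (`pathPos_arc` locates all the vertices involved).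
[cite: AharonovJonesLandau2009, Claim 2.4 (first two relations: "no loops are created… isotopy invariance", eq. (2.1) `b_{ℓ+1}c_ℓ = 1 = a_{ℓ-1}d_ℓ`)] -/
theorem linkVec_splice_main (h : M.mate (genFst i) ≠ genSnd i) {q : Cryptography.QReg n} (hv : IsGkPath k n q)
    (hne : q (genFst i) ≠ q (genSnd i))
    (hrest : ∀ t : Fin n, t ≠ genFst i → t ≠ genSnd i → t ≠ M.mate (genFst i) →
      t ≠ M.mate (genSnd i) → q (M.mate t) = !q t)
    (hqe : q (M.mate (genSnd i)) = !q (M.mate (genFst i))) :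
    (if IsGkPath k n (flipTo q i (q (M.mate (genSnd i)))) then
        Real.sqrt (ajlWeight k (pathPos q i + stepSign (q (genFst i))) *
          ajlWeight k (pathPos q i + stepSign (q (M.mate (genSnd i))))) / ajlWeight k (pathPos q i)
      else 0) * linkVec k M (flipTo q i (q (M.mate (genSnd i)))) = linkVec k (M.splice i h) q := by
  -- notation-free names
  have hsnd := snd_eq_not_fst_of_ne hne
  have hc0 : M.mate (genFst i) ≠ genFst i := M.mate_ne _
  have he1 : M.mate (genSnd i) ≠ genSnd i := M.mate_ne _
  have he0 : M.mate (genSnd i) ≠ genFst i := NCMatching.mate_snd_ne_fst h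
  have hce : M.mate (genFst i) ≠ M.mate (genSnd i) := NCMatching.mate_fst_ne_mate_snd
  have vne : ∀ {x y : Fin n}, x ≠ y → (x : ℕ) ≠ y := fun hxy hv => hxy (Fin.ext hv)
  have hv01 : ((genSnd i : Fin n) : ℕ) = (genFst i : ℕ) + 1 := by simp
  have hgi : ((genFst i : Fin n) : ℕ) = (i : ℕ) := rfl
  have hgs : ((genSnd i : Fin n) : ℕ) = (i : ℕ) + 1 := rfl
  have hmc : M.mate (M.mate (genFst i)) = genFst i := M.mate_mate _
  have hme : M.mate (M.mate (genSnd i)) = genSnd i := M.mate_mate _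
  -- the flip `p⋆` and its compatibility
  set b := q (M.mate (genSnd i)) with hb
  have hcompat : M.Compatible (flipTo q i b) :=
    (NCMatching.compatible_flipTo_iff_of_ne h b).2 ⟨hrest, hqe, hb⟩
  have hcompat' : (M.splice i h).Compatible q :=
    (NCMatching.compatible_splice_iff h).2 ⟨hrest, hsnd, hqe⟩
  -- positions of `p⋆`: `z'_{i+1} = z + ε(b)`, all others those of `q`
  have hPne : ∀ j : ℕ, j ≠ (i : ℕ) + 1 → pathPos (flipTo q i b) j = pathPos q j :=
    fun j hj => pathPos_flipTo_of_ne q i b hsnd hj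
  have hPi1 : pathPos (flipTo q i b) ((i : ℕ) + 1) = pathPos q i + stepSign b := by
    rw [pathPos_succ _ (by omega : (i : ℕ) < n), show (⟨(i : ℕ), _⟩ : Fin n) = genFst i from rfl,
      flipTo_genFst, pathPos_flipTo_of_le q i b le_rfl]
  have hP2 : pathPos q ((i : ℕ) + 1 + 1) = pathPos q i := pathPos_add_two hsnd
  have hzb := hv.bounds (show (i : ℕ) ≤ n by omega)
  have hzpos := ajlWeight_pos hzb
  -- the two arcs of `M` through `i` and `i+1`, by `pathPos_arc`
  have arc_c := M.pathPos_arc hcompat   -- to be applied to the left endpoints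
  -- unfold both link vectors and peel the four special points
  rw [linkVec_eq_prod_arcFactor k (M.splice i h) q,
    if_pos (show IsGkPath k n q ∧ (M.splice i h).Compatible q from ⟨hv, hcompat'⟩),
    linkVec_eq_prod_arcFactor k M (flipTo q i b),
    prod_univ_peel4 (arcFactor k M (flipTo q i b)) (genFst_ne_genSnd i) hc0.symm he0.symm
      (fun e => h e.symm) he1.symm hce,
    prod_univ_peel4 (arcFactor k (M.splice i h) q) (genFst_ne_genSnd i) hc0.symm he0.symm
      (fun e => h e.symm) he1.symm hce,
    Finset.prod_congr rfl fun a ha => arcFactor_splice_of_ne M h hsnd b (mem_erase4.1 ha).1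
      (mem_erase4.1 ha).2.1 (mem_erase4.1 ha).2.2.1 (mem_erase4.1 ha).2.2.2]
  set R := ∏ x ∈ (((Finset.univ.erase (genFst i)).erase (genSnd i)).erase (M.mate (genFst i))).erase
      (M.mate (genSnd i)), arcFactor k (M.splice i h) q x
  -- the special factors of `M ⋆ i` at `i`, `i+1`
  have f0' : arcFactor k (M.splice i h) q (genFst i) =
      Real.sqrt (ajlWeight k (pathPos q i + stepSign (q (genFst i))) / ajlWeight k (pathPos q i)) := by
    have : (M.splice i h).mate (genFst i) = genSnd i := NCMatching.spliceMate_fst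
    have hlt : genFst i < (M.splice i h).mate (genFst i) := by rw [this]; exact Fin.lt_def.2 (by omega)
    rw [arcFactor, if_pos hlt, genFst_val,
      pathPos_succ _ (by omega : (i : ℕ) < n), show (⟨(i : ℕ), _⟩ : Fin n) = genFst i from rfl]
  have f1' : arcFactor k (M.splice i h) q (genSnd i) = 1 := by
    have : (M.splice i h).mate (genSnd i) = genFst i := NCMatching.spliceMate_snd
    have hnlt : ¬ genSnd i < (M.splice i h).mate (genSnd i) := by
      rw [this]; exact not_lt.2 (Fin.le_def.2 (by omega))
    rw [arcFactor, if_neg hnlt]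
  have mc' : (M.splice i h).mate (M.mate (genFst i)) = M.mate (genSnd i) :=
    NCMatching.spliceMate_mate_fst h
  have me' : (M.splice i h).mate (M.mate (genSnd i)) = M.mate (genFst i) :=
    NCMatching.spliceMate_mate_snd h
  rw [f0', f1', mul_one]
  -- three configurations
  rcases Nat.lt_or_ge ((M.mate (genFst i) : Fin n) : ℕ) (genFst i) with hci | hci
  · -- `c < i`: the arc `(c, i)` of `M`; `pathPos_arc` at `c`
    have hclt : M.mate (genFst i) < M.mate (M.mate (genFst i)) := by rw [hmc]; exact Fin.lt_def.2 hci
    obtain ⟨A1, A2⟩ := arc_c (M.mate (genFst i)) hclt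
    rw [hmc] at A1 A2
    -- `z'_{c+1} = z'_i = z` and `z'_c = z'_{i+1} = z + ε(b)`
    rw [genFst_val, hPne (i : ℕ) (by omega),
      hPne ((M.mate (genFst i) : ℕ) + 1) (by have := vne hc0; omega)] at A1
    rw [genFst_val, hPne (M.mate (genFst i) : ℕ) (by have := vne h; omega), hPi1] at A2
    -- validity of the flip: its only new position is `z'_{i+1} = z_c`
    have hcb := hv.bounds (show ((M.mate (genFst i) : Fin n) : ℕ) ≤ n by omega)
    rw [A2] at hcb
    have hvalid : IsGkPath k n (flipTo q i b) := isGkPath_flipTo hv hsnd b hcb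
    have hwpos := ajlWeight_pos hcb
    rw [if_pos hvalid,
      if_pos (show IsGkPath k n (flipTo q i b) ∧ M.Compatible (flipTo q i b) from ⟨hvalid, hcompat⟩)]
    -- the factor of `M` at `i` is `1` (`i` is a right endpoint), at `c` it is `√(λ_z/λ_{z+ε(b)})`
    have f0 : arcFactor k M (flipTo q i b) (genFst i) = 1 := by
      rw [arcFactor, if_neg (not_lt.2 (Fin.le_def.2 hci.le))]
    have fc : arcFactor k M (flipTo q i b) (M.mate (genFst i)) =
        Real.sqrt (ajlWeight k (pathPos q i) / ajlWeight k (pathPos q i + stepSign b)) := by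
      rw [arcFactor, if_pos hclt, hPne ((M.mate (genFst i) : ℕ) + 1) (by have := vne hc0; omega),
        hPne (M.mate (genFst i) : ℕ) (by have := vne h; omega), A1, A2]
    rcases Nat.lt_or_ge ((genSnd i : Fin n) : ℕ) (M.mate (genSnd i)) with hie | hie
    · -- configuration 1: `c < i < i+1 < e`
      have helt : genSnd i < M.mate (genSnd i) := Fin.lt_def.2 hie
      have f1 : arcFactor k M (flipTo q i b) (genSnd i) =
          Real.sqrt (ajlWeight k (pathPos q i) / ajlWeight k (pathPos q i + stepSign b)) := by
        rw [arcFactor, if_pos helt, genSnd_val, hPne ((i : ℕ) + 1 + 1) (by omega), hP2, hPi1]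
      have fe : arcFactor k M (flipTo q i b) (M.mate (genSnd i)) = 1 := by
        have hn : ¬ M.mate (genSnd i) < M.mate (M.mate (genSnd i)) := by rw [hme]; exact not_lt.2 helt.le
        rw [arcFactor, if_neg hn]
      -- `M ⋆ i`: `c < e`, factor at `c` is `√(λ_{z_{c+1}}/λ_{z_c}) = √(λ_z/λ_{z+ε(b)})`, at `e` it is `1`
      have hce_lt : ((M.mate (genFst i) : Fin n) : ℕ) < M.mate (genSnd i) := by omega
      have fc' : arcFactor k (M.splice i h) q (M.mate (genFst i)) =
          Real.sqrt (ajlWeight k (pathPos q i) / ajlWeight k (pathPos q i + stepSign b)) := by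
        have hp : M.mate (genFst i) < (M.splice i h).mate (M.mate (genFst i)) := by
          rw [mc']; exact Fin.lt_def.2 hce_lt
        rw [arcFactor, if_pos hp, A1, A2]
      have fe' : arcFactor k (M.splice i h) q (M.mate (genSnd i)) = 1 := by
        have hn : ¬ M.mate (genSnd i) < (M.splice i h).mate (M.mate (genSnd i)) := by
          rw [me']; exact not_lt.2 (Fin.le_def.2 hce_lt.le)
        rw [arcFactor, if_neg hn]
      rw [f0, f1, fc, fe, fc', fe']
      obtain ⟨e1, -⟩ := l2_algebra (ajlWeight_nonneg k (pathPos q i + stepSign (q (genFst i))))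
        hwpos hzpos
      calc _ = Real.sqrt (ajlWeight k (pathPos q i + stepSign (q (genFst i))) *
              ajlWeight k (pathPos q i + stepSign b)) / ajlWeight k (pathPos q i) *
            Real.sqrt (ajlWeight k (pathPos q i) / ajlWeight k (pathPos q i + stepSign b)) *
            (Real.sqrt (ajlWeight k (pathPos q i) / ajlWeight k (pathPos q i + stepSign b)) * R) := by ring
        _ = _ := by rw [e1]; ring
    · -- configuration 2: `e < c < i < i+1`
      have helt : M.mate (genSnd i) < genSnd i := Fin.lt_def.2 (by have := vne he1; omega)
      obtain ⟨B1, B2⟩ := arc_c (M.mate (genSnd i)) (by rw [hme]; exact helt)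
      rw [hme] at B1 B2
      rw [genSnd_val, hPne ((M.mate (genSnd i) : ℕ) + 1) (by have := vne he0; omega), hPi1] at B1
      rw [genSnd_val, hPne (M.mate (genSnd i) : ℕ) (by have := vne he1; omega),
        hPne ((i : ℕ) + 1 + 1) (by omega), hP2] at B2
      have f1 : arcFactor k M (flipTo q i b) (genSnd i) = 1 := by
        have hn : ¬ genSnd i < M.mate (genSnd i) := not_lt.2 helt.le
        rw [arcFactor, if_neg hn]
      have fe : arcFactor k M (flipTo q i b) (M.mate (genSnd i)) =
          Real.sqrt (ajlWeight k (pathPos q i + stepSign b) / ajlWeight k (pathPos q i)) := by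
        have hp : M.mate (genSnd i) < M.mate (M.mate (genSnd i)) := by rw [hme]; exact helt
        rw [arcFactor, if_pos hp,
          hPne ((M.mate (genSnd i) : ℕ) + 1) (by have := vne he0; omega),
          hPne (M.mate (genSnd i) : ℕ) (by have := vne he1; omega), B1, B2]
      -- `e < c` (non-crossing: `c` is not inside `(e, i+1)` unless... it is: `e < c < i+1`; fine) :
      have hec : ((M.mate (genSnd i) : Fin n) : ℕ) < M.mate (genFst i) := by
        -- `e < i+1`; if `c < e` then `e` inside `(c, i)` forces `mate e = i+1` inside `(c, i)`
        by_contra hh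
        have x : ((M.mate (genFst i) : Fin n) : ℕ) < M.mate (genSnd i) := by have := vne hce; omega
        obtain ⟨-, y⟩ := M.nc_val (M.mate (genFst i)) (M.mate (genSnd i)) x
          (by rw [hmc]; have := Fin.lt_def.1 helt; omega)
        rw [hme, hmc] at y
        have := Fin.lt_def.1 helt
        omega
      have fc' : arcFactor k (M.splice i h) q (M.mate (genFst i)) = 1 := by
        have hn : ¬ M.mate (genFst i) < (M.splice i h).mate (M.mate (genFst i)) := by
          rw [mc']; exact not_lt.2 (Fin.le_def.2 hec.le)
        rw [arcFactor, if_neg hn]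
      have fe' : arcFactor k (M.splice i h) q (M.mate (genSnd i)) =
          Real.sqrt (ajlWeight k (pathPos q i + stepSign b) / ajlWeight k (pathPos q i)) := by
        have hp : M.mate (genSnd i) < (M.splice i h).mate (M.mate (genSnd i)) := by
          rw [me']; exact Fin.lt_def.2 hec
        rw [arcFactor, if_pos hp, B1, B2]
      rw [f0, f1, fc, fe, fc', fe']
      obtain ⟨-, e2⟩ := l2_algebra (le_refl (0 : ℝ)) hwpos hzpos
      have hx := ajlWeight_nonneg k (pathPos q i + stepSign (q (genFst i)))
      calc _ = Real.sqrt (ajlWeight k (pathPos q i + stepSign (q (genFst i))) *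
              ajlWeight k (pathPos q i + stepSign b)) / ajlWeight k (pathPos q i) *
            (Real.sqrt (ajlWeight k (pathPos q i) / ajlWeight k (pathPos q i + stepSign b)) *
              Real.sqrt (ajlWeight k (pathPos q i + stepSign b) / ajlWeight k (pathPos q i))) * R := by
            ring
        _ = _ := by
          rw [e2, mul_one, Real.sqrt_mul hx, Real.sqrt_div hx, Real.sqrt_div hwpos.le]
          have hsl : Real.sqrt (ajlWeight k (pathPos q i)) ≠ 0 := (Real.sqrt_pos.2 hzpos).ne'
          field_simp
          rw [Real.sq_sqrt hzpos.le]
          ring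
  · -- configuration 3: `i < i+1 < e < c`
    have hic : ((genFst i : Fin n) : ℕ) < M.mate (genFst i) := by have := vne hc0; omega
    have hclt : genFst i < M.mate (genFst i) := Fin.lt_def.2 hic
    -- `i+1 < e < c` by non-crossing
    have hie : ((genSnd i : Fin n) : ℕ) < M.mate (genSnd i) ∧
        ((M.mate (genSnd i) : Fin n) : ℕ) < M.mate (genFst i) := by
      have hi1c : ((genSnd i : Fin n) : ℕ) < M.mate (genFst i) := by have := vne h; omega
      obtain ⟨x, y⟩ := M.nc_val (genFst i) (genSnd i) (by omega) hi1c
      exact ⟨by have := vne he1; have := vne he0; omega, y⟩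
    have helt : genSnd i < M.mate (genSnd i) := Fin.lt_def.2 hie.1
    obtain ⟨A1, A2⟩ := arc_c (genFst i) hclt
    rw [genFst_val, hPi1, hPne (M.mate (genFst i) : ℕ) (by have := vne h; omega)] at A1
    rw [genFst_val, hPne (i : ℕ) (by omega),
      hPne ((M.mate (genFst i) : ℕ) + 1) (by have := vne hc0; omega)] at A2
    obtain ⟨B1, B2⟩ := arc_c (genSnd i) helt
    rw [genSnd_val, hPne ((i : ℕ) + 1 + 1) (by omega), hP2,
      hPne (M.mate (genSnd i) : ℕ) (by have := vne he1; omega)] at B1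
    rw [genSnd_val, hPi1, hPne ((M.mate (genSnd i) : ℕ) + 1) (by have := vne he0; omega)] at B2
    -- validity: `z + ε(b) = z_{e+1}`
    have heb := hv.bounds (show ((M.mate (genSnd i) : Fin n) : ℕ) + 1 ≤ n by omega)
    rw [← B2] at heb
    have hvalid : IsGkPath k n (flipTo q i b) := isGkPath_flipTo hv hsnd b heb
    have hwpos := ajlWeight_pos heb
    rw [if_pos hvalid,
      if_pos (show IsGkPath k n (flipTo q i b) ∧ M.Compatible (flipTo q i b) from ⟨hvalid, hcompat⟩)]
    have f0 : arcFactor k M (flipTo q i b) (genFst i) =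
        Real.sqrt (ajlWeight k (pathPos q i + stepSign b) / ajlWeight k (pathPos q i)) := by
      rw [arcFactor, if_pos hclt, genFst_val, hPi1, hPne (i : ℕ) (by omega)]
    have fc : arcFactor k M (flipTo q i b) (M.mate (genFst i)) = 1 := by
      have hn : ¬ M.mate (genFst i) < M.mate (M.mate (genFst i)) := by rw [hmc]; exact not_lt.2 hclt.le
      rw [arcFactor, if_neg hn]
    have f1 : arcFactor k M (flipTo q i b) (genSnd i) =
        Real.sqrt (ajlWeight k (pathPos q i) / ajlWeight k (pathPos q i + stepSign b)) := by
      rw [arcFactor, if_pos helt, genSnd_val, hPne ((i : ℕ) + 1 + 1) (by omega), hP2, hPi1]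
    have fe : arcFactor k M (flipTo q i b) (M.mate (genSnd i)) = 1 := by
      have hn : ¬ M.mate (genSnd i) < M.mate (M.mate (genSnd i)) := by rw [hme]; exact not_lt.2 helt.le
      rw [arcFactor, if_neg hn]
    have fc' : arcFactor k (M.splice i h) q (M.mate (genFst i)) = 1 := by
      have hn : ¬ M.mate (genFst i) < (M.splice i h).mate (M.mate (genFst i)) := by
        rw [mc']; exact not_lt.2 (Fin.le_def.2 hie.2.le)
      rw [arcFactor, if_neg hn]
    have fe' : arcFactor k (M.splice i h) q (M.mate (genSnd i)) =
        Real.sqrt (ajlWeight k (pathPos q i + stepSign b) / ajlWeight k (pathPos q i)) := by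
      have hp : M.mate (genSnd i) < (M.splice i h).mate (M.mate (genSnd i)) := by
        rw [me']; exact Fin.lt_def.2 hie.2
      rw [arcFactor, if_pos hp, ← B1, ← B2]
    rw [f0, f1, fc, fe, fc', fe']
    obtain ⟨-, e2⟩ := l2_algebra (le_refl (0 : ℝ)) hwpos hzpos
    have hx := ajlWeight_nonneg k (pathPos q i + stepSign (q (genFst i)))
    calc _ = Real.sqrt (ajlWeight k (pathPos q i + stepSign (q (genFst i))) *
            ajlWeight k (pathPos q i + stepSign b)) / ajlWeight k (pathPos q i) *
          (Real.sqrt (ajlWeight k (pathPos q i) / ajlWeight k (pathPos q i + stepSign b)) *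
            Real.sqrt (ajlWeight k (pathPos q i + stepSign b) / ajlWeight k (pathPos q i))) * R := by
          ring
      _ = _ := by
        rw [e2, mul_one, Real.sqrt_mul hx, Real.sqrt_div hx, Real.sqrt_div hwpos.le]
        have hsl : Real.sqrt (ajlWeight k (pathPos q i)) ≠ 0 := (Real.sqrt_pos.2 hzpos).ne'
        field_simp
        rw [Real.sq_sqrt hzpos.le]
        ring

/-- **L2: `Φ_i v_M = v_{M ⋆ i}` when `M(i) ≠ i + 1`** (a capcup joining two different strands
splices the cap state, no loop is closed). [cite: AharonovJonesLandau2009, Claim 2.4 (isotopy relations) with Def. 2.5] -/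
theorem linkVec_splice (h : M.mate (genFst i) ≠ genSnd i) :
    (ajlPhi k n i).mulVec (linkVec k M) = linkVec k (M.splice i h) := by
  ext q
  by_cases hq : IsGkPath k n q ∧ q (genFst i) ≠ q (genSnd i)
  · obtain ⟨hv, hne⟩ := hq
    rw [ajlPhi_mulVec_eq, ajlPhi_apply_flipTo hv hne, ajlPhi_apply_flipTo hv hne]
    by_cases hgood : (∀ t : Fin n, t ≠ genFst i → t ≠ genSnd i → t ≠ M.mate (genFst i) →
        t ≠ M.mate (genSnd i) → q (M.mate t) = !q t) ∧ q (M.mate (genSnd i)) = !q (M.mate (genFst i))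
    · obtain ⟨hrest, hqe⟩ := hgood
      -- the flip with the other bit is incompatible with `M`
      have hzero : linkVec k M (flipTo q i (!q (M.mate (genSnd i)))) = 0 := by
        rw [linkVec_apply, if_neg]
        rintro ⟨-, hc⟩
        have := ((NCMatching.compatible_flipTo_iff_of_ne h _).1 hc).2.2
        cases hb : q (M.mate (genSnd i)) <;> rw [hb] at this <;> simp at this
      rw [← linkVec_splice_main M h hv hne hrest hqe]
      cases hb : q (M.mate (genSnd i))
      · rw [hb, Bool.not_false] at hzero
        rw [hzero, mul_zero, zero_add]
      · rw [hb, Bool.not_true] at hzero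
        rw [hzero, mul_zero, add_zero]
    · -- both sides vanish
      have h0 : ∀ b, linkVec k M (flipTo q i b) = 0 := fun b => by
        rw [linkVec_apply, if_neg]
        rintro ⟨-, hc⟩
        obtain ⟨hr, hb1, hb2⟩ := (NCMatching.compatible_flipTo_iff_of_ne h b).1 hc
        exact hgood ⟨hr, by rw [← hb2, hb1]⟩
      rw [h0, h0, mul_zero, mul_zero, add_zero, linkVec_apply, if_neg]
      rintro ⟨-, hc⟩
      obtain ⟨hr, -, hce⟩ := (NCMatching.compatible_splice_iff h).1 hc
      exact hgood ⟨hr, hce⟩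
  · rw [ajlPhi_mulVec_eq_zero _ hq, linkVec_apply, if_neg]
    rintro ⟨hv, hc⟩
    have e := ((NCMatching.compatible_splice_iff h).1 hc).2.1
    exact hq ⟨hv, by rw [e]; cases q (genFst i) <;> decide⟩

end L2

/-! ### The slice machine: running a smoothed braid word on cap states -/

section SliceMachine

variable {k : ℕ}

/-- One slice of a smoothed diagram acting on a cap state `(M, c)`: the identity smoothing does
nothing; a capcup at `g` closes a loop if `g`, `g+1` are partners, and splices `M` otherwise.
[cite: AharonovJonesLandau2009, Def. 2.5 and Def. 2.9 (`|σ|`)] -/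
def sliceStep (st : NCMatching n × ℕ) (g : Fin (n - 1)) (sm : Bool) : NCMatching n × ℕ :=
  if sm then (if h : st.1.mate (genFst g) = genSnd g then (st.1, st.2 + 1) else (st.1.splice g h, st.2))
  else st

/-- The matrix of a slice: `Φ_g` for a capcup, `1` for the identity smoothing.
[cite: AharonovJonesLandau2009, §3.1] -/
def sliceMatrix (k n : ℕ) (g : Fin (n - 1)) (sm : Bool) : Matrix (Cryptography.QReg n) (Cryptography.QReg n) ℝ :=
  if sm then ajlPhi k n g else 1

/-- Running a list of slices (bottom slice first) on a cap state. [cite: AharonovJonesLandau2009, Def. 2.5] -/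
def runSlices (L : List (Fin (n - 1) × Bool)) (st : NCMatching n × ℕ) : NCMatching n × ℕ :=
  L.foldl (fun st gs => sliceStep st gs.1 gs.2) st

/-- `runSlices` on a cons. [folklore] -/
theorem runSlices_cons (gs : Fin (n - 1) × Bool) (L : List (Fin (n - 1) × Bool)) (st : NCMatching n × ℕ) :
    runSlices (gs :: L) st = runSlices L (sliceStep st gs.1 gs.2) := rfl

/-- `runSlices` on an append. [folklore] -/
theorem runSlices_append (L L' : List (Fin (n - 1) × Bool)) (st : NCMatching n × ℕ) :
    runSlices (L ++ L') st = runSlices L' (runSlices L st) := by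
  simp [runSlices, List.foldl_append]

/-- **One slice on link states** (L1/L2): `S_g (d^c v_M) = d^{c'} v_{M'}` with `(M', c')` the new
cap state. [cite: AharonovJonesLandau2009, Claim 2.4] -/
theorem sliceMatrix_mulVec_state (hk : 3 ≤ k) (st : NCMatching n × ℕ) (g : Fin (n - 1)) (sm : Bool) :
    (sliceMatrix k n g sm).mulVec (ajlLoopValue k ^ st.2 • linkVec k st.1) =
      ajlLoopValue k ^ (sliceStep st g sm).2 • linkVec k (sliceStep st g sm).1 := by
  cases sm
  · simp [sliceMatrix, sliceStep]
  · simp only [sliceMatrix, sliceStep, if_true]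
    rw [Matrix.mulVec_smul]
    split_ifs with h
    · rw [linkVec_closed st.1 hk h, smul_smul, pow_succ]
    · rw [linkVec_splice st.1 h]

/-- **Running slices on link states**: folding the slice matrices over `d^c v_M` yields
`d^{c'} v_{M'}` for the final cap state `(M', c')`. [cite: AharonovJonesLandau2009, Def. 2.5 and Claim 2.4] -/
theorem foldl_sliceMatrix_mulVec (hk : 3 ≤ k) (L : List (Fin (n - 1) × Bool)) (st : NCMatching n × ℕ) :
    L.foldl (fun v gs => (sliceMatrix k n gs.1 gs.2).mulVec v) (ajlLoopValue k ^ st.2 • linkVec k st.1) =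
      ajlLoopValue k ^ (runSlices L st).2 • linkVec k (runSlices L st).1 := by
  induction L generalizing st with
  | nil => rfl
  | cons gs L ih => rw [List.foldl_cons, sliceMatrix_mulVec_state hk, ih, runSlices_cons]

/-- Folding `mulVec` over a list is `mulVec` by the reversed product. [folklore] -/
theorem foldl_mulVec_eq_prod_reverse (S : Fin (n - 1) × Bool → Matrix (Cryptography.QReg n) (Cryptography.QReg n) ℝ)
    (L : List (Fin (n - 1) × Bool)) (v : Cryptography.QReg n → ℝ) :
    L.foldl (fun v gs => (S gs).mulVec v) v = ((L.map S).reverse.prod).mulVec v := by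
  induction L generalizing v with
  | nil => simp
  | cons gs L ih =>
    rw [List.foldl_cons, ih, List.map_cons, List.reverse_cons, List.prod_append, List.prod_singleton,
      ← Matrix.mulVec_mulVec]

/-! ### Closing the diagram: the capcups `E_{n-2}, …, E_2, E_0` on top -/

/-- The closing slices `E_{2h-2}, …, E_2, E_0` (in this order), all capcup-smoothed.
[cite: AharonovJonesLandau2009, Claim 3.8 (`Φ₁Φ₃⋯Φ_{n-1}`)] -/
def closingList (n : ℕ) : (h : ℕ) → 2 * h ≤ n → List (Fin (n - 1) × Bool)
  | 0, _ => []
  | h + 1, hh => (⟨2 * h, by omega⟩, true) :: closingList n h (by omega)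

/-- The reversed product of the closing slice matrices is `Φ₀ Φ₂ ⋯ Φ_{2h-2}`. [cite: AharonovJonesLandau2009, Claim 3.8] -/
theorem prod_reverse_closingList (k : ℕ) (h : ℕ) (hh : 2 * h ≤ n) :
    ((closingList n h hh).map fun gs => sliceMatrix k n gs.1 gs.2).reverse.prod =
      (List.ofFn fun l : Fin h => ajlPhi k n ⟨2 * (l : ℕ), by omega⟩).prod := by
  induction h with
  | zero => simp [closingList]
  | succ h ih =>
    rw [closingList, List.map_cons, List.reverse_cons, List.prod_append, List.prod_singleton,
      ih (by omega), List.ofFn_succ', List.prod_concat]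
    simp [sliceMatrix, Fin.val_last, Fin.val_castSucc]

/-- Two matchings with the same partner function are equal. [folklore] -/
theorem NCMatching.ext' {M M' : NCMatching n} (h : M.mate = M'.mate) : M = M' := by
  cases M; cases M'; cases h; rfl

/-- After the closing slices every pair `(2l, 2l+1)` is matched (invariant: the pairs above the
slices already processed stay matched). [cite: AharonovJonesLandau2009, Claim 3.8 (proof)] -/
theorem mate_runSlices_closingList (h : ℕ) (hh : 2 * h ≤ n) (st : NCMatching n × ℕ)
    (hst : ∀ l : ℕ, h ≤ l → ∀ hl : 2 * l + 1 < n, st.1.mate ⟨2 * l, by omega⟩ = ⟨2 * l + 1, hl⟩)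
    (l : ℕ) (hl : 2 * l + 1 < n) :
    (runSlices (closingList n h hh) st).1.mate ⟨2 * l, by omega⟩ = ⟨2 * l + 1, hl⟩ := by
  induction h generalizing st with
  | zero => exact hst l (Nat.zero_le _) hl
  | succ h ih =>
    rw [closingList, runSlices_cons]
    apply ih
    intro l' hl' hl'n
    simp only [sliceStep, if_true]
    have e0 : (genFst (⟨2 * h, by omega⟩ : Fin (n - 1)) : Fin n) = ⟨2 * h, by omega⟩ := rfl
    have e1 : (genSnd (⟨2 * h, by omega⟩ : Fin (n - 1)) : Fin n) = ⟨2 * h + 1, by omega⟩ := rfl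
    split_ifs with hm
    · -- nothing changes
      rcases Nat.eq_or_lt_of_le hl' with rfl | hlt
      · rw [e0, e1] at hm; exact hm
      · exact hst l' hlt hl'n
    · -- splice at `2h`
      change NCMatching.spliceMate st.1 ⟨2 * h, _⟩ ⟨2 * l', _⟩ = _
      rcases Nat.eq_or_lt_of_le hl' with rfl | hlt
      · exact NCMatching.spliceMate_fst
      · have h2 := hst l' hlt hl'n
        have n1 : (⟨2 * l', by omega⟩ : Fin n) ≠ genFst (⟨2 * h, by omega⟩ : Fin (n - 1)) := by
          rw [e0]; intro e; have := Fin.ext_iff.1 e; simp at this; omega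
        have n2 : (⟨2 * l', by omega⟩ : Fin n) ≠ genSnd (⟨2 * h, by omega⟩ : Fin (n - 1)) := by
          rw [e1]; intro e; have := Fin.ext_iff.1 e; simp at this; omega
        have n3 : (⟨2 * l', by omega⟩ : Fin n) ≠ st.1.mate (genFst ⟨2 * h, by omega⟩) := by
          intro e
          have := congrArg st.1.mate e
          rw [st.1.mate_mate, h2, e0] at this
          have := Fin.ext_iff.1 this; simp at this; omega
        have n4 : (⟨2 * l', by omega⟩ : Fin n) ≠ st.1.mate (genSnd ⟨2 * h, by omega⟩) := by
          intro e
          have := congrArg st.1.mate e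
          rw [st.1.mate_mate, h2, e1] at this
          have := Fin.ext_iff.1 this; simp at this; omega
        rw [NCMatching.spliceMate_of_ne n1 n2 n3 n4, h2]

/-- **The closing slices return the cap state to the plat cups.** [cite: AharonovJonesLandau2009, Claim 3.8] -/
theorem runSlices_closingList_fst (hn : Even n) (st : NCMatching n × ℕ) :
    (runSlices (closingList n (n / 2) (Nat.mul_div_le n 2)) st).1 = NCMatching.cups hn := by
  apply NCMatching.ext'
  funext t
  have key := mate_runSlices_closingList (n / 2) (Nat.mul_div_le n 2) st
    (fun l hl hl' => by omega)
  set M' := (runSlices (closingList n (n / 2) (Nat.mul_div_le n 2)) st).1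
  apply Fin.ext
  rw [NCMatching.cups_mate_val]
  rcases Nat.even_or_odd (t : ℕ) with ⟨u, hu⟩ | ⟨u, hu⟩
  · have ht : t = ⟨2 * u, by omega⟩ := Fin.ext (by simp; omega)
    have h2 : 2 * u + 1 < n := by obtain ⟨r, hr⟩ := hn; have := t.2; omega
    rw [if_pos ⟨u, hu⟩, ht, key u h2]
  · have h2 : 2 * u + 1 < n := by have := t.2; omega
    have ht : t = ⟨2 * u + 1, h2⟩ := Fin.ext (by simp; omega)
    have hodd : ¬ Even (t : ℕ) := by rw [Nat.not_even_iff_odd]; exact ⟨u, hu⟩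
    have hm : M'.mate ⟨2 * u + 1, h2⟩ = ⟨2 * u, by omega⟩ := by rw [← key u h2, M'.mate_mate]
    rw [if_neg hodd, ht, hm]
    simp

/-! ### The core identity: `d^{n/2} ⟨α| S_{m-1} ⋯ S_0 |α⟩ = d^{c_ext}` -/

/-- The number of loops closed by running the slices `L` on the plat cups and then the closing
capcups `E_{n-2}, …, E_0`: the loop count `|σ|` of the plat closure, computed by the cap-state
calculus. [cite: AharonovJonesLandau2009, Def. 2.9 (`|σ|`) and Def. 2.5] -/
def cExt (hn : Even n) (L : List (Fin (n - 1) × Bool)) : ℕ :=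
  (runSlices (closingList n (n / 2) (Nat.mul_div_le n 2)) (runSlices L (NCMatching.cups hn, 0))).2

/-- The diagonal entry at `α` of a matrix, read off `M |α⟩`. [folklore] -/
theorem apply_alpha_eq_mulVec (X : Matrix (Cryptography.QReg n) (Cryptography.QReg n) ℝ) :
    X (ajlAlpha n) (ajlAlpha n) = (X.mulVec (Pi.single (ajlAlpha n) 1)) (ajlAlpha n) := by
  rw [Matrix.mulVec_single_one, Matrix.col_apply]

/-- `(|α⟩⟨α| X)(α, α) = X(α, α)`. [folklore] -/
theorem ajlAlphaProj_mul_apply (X : Matrix (Cryptography.QReg n) (Cryptography.QReg n) ℝ) :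
    (ajlAlphaProj n * X) (ajlAlpha n) (ajlAlpha n) = X (ajlAlpha n) (ajlAlpha n) := by
  rw [Matrix.mul_apply, Finset.sum_eq_single (ajlAlpha n)]
  · simp [ajlAlphaProj]
  · intro p _ hp; simp [ajlAlphaProj, hp]
  · simp

/-- **The core identity of the tree proof of Thm. 3.2.** For every list of slices `L` (a smoothed
braid word read bottom-up), `d^{n/2} · ⟨α| S_L |α⟩ = d^{c_ext(L)}`, where `S_L` is the product of
the slice matrices (last slice leftmost) and `c_ext(L)` the loop number of the cap-state calculus:
apply `Φ₀Φ₂⋯Φ_{n-2} · S_L` to `v_{cups} = (√d)^{n/2}|α⟩` along L1–L3 (it returns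
`d^{c_ext} v_{cups}`), and use Claim 3.8 (`Φ₀Φ₂⋯Φ_{n-2} = d^{n/2}|α⟩⟨α|`) on the other side.
[cite: AharonovJonesLandau2009, Thm. 3.2 (proof) and Claim 3.8] -/
theorem core_identity (hk : 3 ≤ k) (hn : Even n) (L : List (Fin (n - 1) × Bool)) :
    ajlLoopValue k ^ (n / 2) *
        (L.map fun gs => sliceMatrix k n gs.1 gs.2).reverse.prod (ajlAlpha n) (ajlAlpha n) =
      ajlLoopValue k ^ cExt hn L := by
  set X := (L.map fun gs => sliceMatrix k n gs.1 gs.2).reverse.prod with hX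
  set C := closingList n (n / 2) (Nat.mul_div_le n 2) with hC
  set PC := (C.map fun gs => sliceMatrix k n gs.1 gs.2).reverse.prod with hPC
  have hd : 0 < ajlLoopValue k := ajlLoopValue_pos hk
  -- Claim 3.8
  have h38 : PC = ajlLoopValue k ^ (n / 2) • ajlAlphaProj n := by
    rw [hPC, hC, prod_reverse_closingList, List.ofFn_eq_map]
    exact ajl_claim38 k n hk hn
  -- (i) `(PC X)(α,α) = d^{n/2} X(α,α)`
  have h1 : (PC * X) (ajlAlpha n) (ajlAlpha n) = ajlLoopValue k ^ (n / 2) * X (ajlAlpha n) (ajlAlpha n) := by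
    rw [h38, Matrix.smul_mul, Matrix.smul_apply, smul_eq_mul, ajlAlphaProj_mul_apply]
  -- (ii) `(PC X) v_cups = d^{c_ext} v_cups`
  have h2 : (PC * X).mulVec (linkVec k (NCMatching.cups hn)) =
      ajlLoopValue k ^ cExt hn L • linkVec k (NCMatching.cups hn) := by
    have e : PC * X = ((L ++ C).map fun gs => sliceMatrix k n gs.1 gs.2).reverse.prod := by
      rw [List.map_append, List.reverse_append, List.prod_append]
    have := foldl_sliceMatrix_mulVec hk (L ++ C) (NCMatching.cups hn, 0)
    rw [pow_zero, one_smul, foldl_mulVec_eq_prod_reverse, runSlices_append] at this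
    rw [e, this, cExt, ← hC, runSlices_closingList_fst hn]
  -- (iii) evaluate (ii) at `α`, using `v_cups = (√d)^{n/2} |α⟩`
  have hcups : linkVec k (NCMatching.cups hn) = Real.sqrt (ajlLoopValue k) ^ (n / 2) •
      (Pi.single (ajlAlpha n) (1 : ℝ) : Cryptography.QReg n → ℝ) := by
    funext p
    rw [linkVec_cups hk hn, Pi.smul_apply, Pi.single_apply, smul_eq_mul, mul_ite, mul_one, mul_zero]
  have h3 : (PC * X) (ajlAlpha n) (ajlAlpha n) = ajlLoopValue k ^ cExt hn L := by
    have := congr_fun h2 (ajlAlpha n)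
    rw [hcups, Matrix.mulVec_smul, Pi.smul_apply, Pi.smul_apply, Pi.smul_apply, smul_eq_mul, smul_eq_mul,
      smul_eq_mul, ← apply_alpha_eq_mulVec, Pi.single_eq_same, mul_one] at this
    have hs : Real.sqrt (ajlLoopValue k) ^ (n / 2) ≠ 0 := pow_ne_zero _ (Real.sqrt_pos.2 hd).ne'
    calc (PC * X) (ajlAlpha n) (ajlAlpha n)
        = Real.sqrt (ajlLoopValue k) ^ (n / 2) * (PC * X) (ajlAlpha n) (ajlAlpha n) /
            Real.sqrt (ajlLoopValue k) ^ (n / 2) := by field_simp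
      _ = _ := by rw [this]; field_simp
  rw [← h1, h3]

/-! ### From the core identity to the matrix element of `φ(w)` -/

/-- Slice matrices are symmetric. [cite: AharonovJonesLandau2009, Claim 3.1] -/
theorem sliceMatrix_transpose (k n : ℕ) (g : Fin (n - 1)) (sm : Bool) :
    (sliceMatrix k n g sm)ᵀ = sliceMatrix k n g sm := by
  cases sm
  · simp [sliceMatrix]
  · simp [sliceMatrix, ajlPhi_transpose]

/-- The `(α, α)` entry of a product of slice matrices does not depend on the order of the
product (transpose symmetry). [folklore] -/
theorem prod_sliceMatrix_apply_alpha_eq_reverse (k n : ℕ) (L : List (Fin (n - 1) × Bool)) :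
    (L.map fun gs => sliceMatrix k n gs.1 gs.2).prod (ajlAlpha n) (ajlAlpha n) =
      (L.map fun gs => sliceMatrix k n gs.1 gs.2).reverse.prod (ajlAlpha n) (ajlAlpha n) := by
  conv_lhs => rw [← transpose_apply (L.map fun gs => sliceMatrix k n gs.1 gs.2).prod (ajlAlpha n) (ajlAlpha n),
    Matrix.transpose_list_prod, List.map_map]
  rw [show (transpose ∘ fun gs : Fin (n - 1) × Bool => sliceMatrix k n gs.1 gs.2) =
      fun gs => sliceMatrix k n gs.1 gs.2 from funext fun gs => sliceMatrix_transpose k n gs.1 gs.2]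

/-- **Expansion of an ordered product of binomials** `∏_j (a_j X_j + b_j 1)` into the sum over the
`2^m` choices (the passage from `ρ_A(w)` to the bracket state sum, AJL Lemma 2.2: "a one to one
correspondence between states … and Kauffman diagrams that appear in `ρ_A(B)`").
[cite: AharonovJonesLandau2009, Lemma 2.2 (proof)] -/
theorem prod_ofFn_smul_add {R : Type*} [CommRing R] {ι : Type*} [Fintype ι] [DecidableEq ι] :
    ∀ {m : ℕ} (a b : Fin m → R) (X : Fin m → Matrix ι ι R),
    (List.ofFn fun j => a j • X j + b j • (1 : Matrix ι ι R)).prod =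
      ∑ s : Fin m → Bool, (∏ j, if s j then a j else b j) •
        (List.ofFn fun j => if s j then X j else (1 : Matrix ι ι R)).prod
  | 0, a, b, X => by simp
  | m + 1, a, b, X => by
    rw [List.ofFn_succ, List.prod_cons, prod_ofFn_smul_add (fun j => a j.succ) (fun j => b j.succ)
      (fun j => X j.succ)]
    have key : ∀ F : (Fin (m + 1) → Bool) → Matrix ι ι R,
        ∑ s, F s = ∑ c : Bool, ∑ s' : Fin m → Bool, F (Fin.cons c s') := by
      intro F
      rw [← Fintype.sum_prod_type', Fintype.sum_equiv (Fin.consEquiv fun _ => Bool)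
        (fun cs : Bool × (Fin m → Bool) => F (Fin.cons cs.1 cs.2)) F (fun _ => rfl)]
    rw [key, Fintype.sum_bool, Finset.mul_sum, ← Finset.sum_add_distrib]
    refine Finset.sum_congr rfl fun s' _ => ?_
    simp only [Fin.prod_univ_succ, Fin.cons_zero, Fin.cons_succ, List.ofFn_succ, List.prod_cons,
      if_true, if_false, Bool.false_eq_true, Matrix.one_mul, add_mul, Matrix.smul_mul, Matrix.mul_smul,
      smul_smul]
    ring_nf

/-- The complex slice matrix: `(if s then Φ else 1)` over `ℂ` is the image of the real one. [folklore] -/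
theorem sliceMatrix_map (k n : ℕ) (g : Fin (n - 1)) (sm : Bool) :
    (sliceMatrix k n g sm).map ((↑) : ℝ → ℂ) = if sm then ajlPhiC k n g else 1 := by
  cases sm
  · simp [sliceMatrix, Matrix.map_one]
  · simp [sliceMatrix, ajlPhiC]

/-- Mapping a product of real matrices to `ℂ` entrywise. [folklore] -/
theorem map_ofReal_list_prod {ι : Type*} [Fintype ι] [DecidableEq ι] (L : List (Matrix ι ι ℝ)) :
    (L.prod).map ((↑) : ℝ → ℂ) = (L.map fun M => M.map ((↑) : ℝ → ℂ)).prod := by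
  induction L with
  | nil => simp [Matrix.map_one]
  | cons M L ih =>
    rw [List.prod_cons, List.map_cons, List.prod_cons, ← ih]
    ext i j
    simp [Matrix.mul_apply, Matrix.map_apply, Complex.ofReal_sum, Complex.ofReal_mul]

/-- The loop number is at least one (the diagram is nonempty for `n ≥ 1`). [folklore] -/
theorem one_le_loopCount {m : ℕ} (hn : 1 ≤ n) (w : Fin m → Fin (n - 1) × Bool) (s : Fin m → Bool) :
    1 ≤ loopCount w s := by
  unfold loopCount
  haveI : Nonempty (smoothingGraph w s).ConnectedComponent :=
    ⟨(smoothingGraph w s).connectedComponentMk (0, ⟨0, hn⟩)⟩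
  exact Nat.card_pos

/-- **Thm. 3.2 from the loop-count recursion.** If the tree's loop number `loopCount` (connected
components of the smoothed plat diagram) agrees with the cap-state count `cExt`, then
`⟨α|φ(w)|α⟩ = ⟨w^{pl}⟩(A_k)/d^{n/2-1}` (`ajl_thm32_matrixElement`): expand `φ(w) = ∏(cΦ + c'1)`
into the `2^m` smoothings, apply `core_identity` to each, and compare with the state sum
`kauffmanBracketPlat` termwise. [cite: AharonovJonesLandau2009, Thm. 3.2 and Lemma 2.2] -/
theorem ajl_thm32_of_loopCount
    (hB : ∀ (n m : ℕ) (hn : Even n) (w : Fin m → Fin (n - 1) × Bool) (s : Fin m → Bool),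
      loopCount w s = cExt hn (List.ofFn fun j => ((w j).1, s j))) :
    ajl_thm32_matrixElement := by
  intro k n m w hk hn h2
  have hd : 0 < ajlLoopValue k := ajlLoopValue_pos hk
  have hdC : (ajlLoopValue k : ℂ) ≠ 0 := by exact_mod_cast hd.ne'
  -- expand `φ(w)` into the sum over smoothing states
  have hexp := prod_ofFn_smul_add (fun j => crossingWeight (ajlPoint k) (w j).2 true)
    (fun j => crossingWeight (ajlPoint k) (w j).2 false) (fun j => ajlPhiC k n (w j).1)
  rw [ajlBraidMatrixFn, show (fun j => ajlCrossingMatrix k (w j)) =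
      fun j => crossingWeight (ajlPoint k) (w j).2 true • ajlPhiC k n (w j).1 +
        crossingWeight (ajlPoint k) (w j).2 false • (1 : Matrix (Cryptography.QReg n) (Cryptography.QReg n) ℂ) from rfl,
    hexp, Matrix.sum_apply, kauffmanBracketPlat, Finset.sum_div]
  refine Finset.sum_congr rfl fun s _ => ?_
  rw [Matrix.smul_apply, smul_eq_mul, loopValue_ajlPoint]
  -- the coefficients agree
  have hcoef : (∏ j, if s j then crossingWeight (ajlPoint k) (w j).2 true
      else crossingWeight (ajlPoint k) (w j).2 false) = ∏ j, crossingWeight (ajlPoint k) (w j).2 (s j) :=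
    Finset.prod_congr rfl fun j _ => by cases s j <;> rfl
  rw [hcoef, mul_div_assoc]
  congr 1
  -- the matrix entry: pass to the real slice matrices, reverse the product, apply the core identity
  set L : List (Fin (n - 1) × Bool) := List.ofFn fun j => ((w j).1, s j) with hL
  have hreal : (List.ofFn fun j => if s j then ajlPhiC k n (w j).1 else (1 : Matrix (Cryptography.QReg n) (Cryptography.QReg n) ℂ)).prod =
      ((L.map fun gs => sliceMatrix k n gs.1 gs.2).prod).map ((↑) : ℝ → ℂ) := by
    rw [map_ofReal_list_prod, hL, List.map_ofFn, List.map_ofFn]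
    congr 1
    refine congrArg List.ofFn (funext fun j => ?_)
    simp only [Function.comp]
    exact (sliceMatrix_map k n (w j).1 (s j)).symm
  rw [hreal, Matrix.map_apply, prod_sliceMatrix_apply_alpha_eq_reverse]
  have hcore := core_identity hk hn L
  rw [← hB n m hn w s] at hcore
  have hX : (L.map fun gs => sliceMatrix k n gs.1 gs.2).reverse.prod (ajlAlpha n) (ajlAlpha n) =
      ajlLoopValue k ^ loopCount w s / ajlLoopValue k ^ (n / 2) := by
    rw [eq_div_iff (pow_ne_zero _ hd.ne'), mul_comm, hcore]
  rw [hX]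
  push_cast
  -- `d^c / d^{n/2} = d^{c-1} / d^{n/2-1}` for `c, n/2 ≥ 1`
  have hc : 1 ≤ loopCount w s := one_le_loopCount (by omega) w s
  have hh : 1 ≤ n / 2 := by omega
  rw [show loopCount w s = (loopCount w s - 1) + 1 by omega, show n / 2 = (n / 2 - 1) + 1 by omega,
    pow_succ, pow_succ, Nat.add_sub_cancel, Nat.add_sub_cancel, mul_div_mul_right _ _ hdC]

end SliceMachine

end Literature.Computability.QuantumComplexity

end
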